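import Mathlib
import Summits.NavierStokesRegularity.NavierStokesRegularity.Theorems.EulerZoomLiouvillePowerGaugeEulerLiouvilleSwirlfreeLedgerDecay
import Summits.NavierStokesRegularity.NavierStokesRegularity.Theorems.EulerZoomLiouvillePowerGaugeEulerLiouvilleBackwardTools
import Literature.Analysis.FluidPDE.ClassicalSolutionCalculus
/-!
# Line `chiral_anchor` — COMPANION MODULE «K4 PROVED»: the ANCHOR RACE, sorry-free (ideator ns-idea-11 g10/g11, line g10-2, REV4; REV7-sync:
# `IsChiralTubePast` text = the LEAD's v114 binder verbatim, `IsTubeDatum`/`tubeHelicity` unfolded — definitionally the old text; nothing else changed)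
# crux `EulerZoomLiouville.PowerGaugeEulerLiouville` = stmt-NavierStokesRegularity-19832

NO SUMMIT AND NO CRUX IS PROVED HERE.  This module proves, WITHOUT `sorry`, stub K4 `stub_anchorRace` of the line `Lines/chiral_anchor.lean`:
`ChiralAnchorK4.anchorRace : ShellHelicityFloor → FarVolumeBound → ∀ ρ > 0, ∀ u p H c, InClass ρ u p H c → IsChiralTubePast u p → HasAnchorFlows u → False`
— the chiral-tube stratum is EMPTY in Seregin's class for EVERY `ρ > 0`, given the shell helicity floor (K2, proved in the line file, REV2) and the
far-volume bound (K3, proved in the line file, REV3) and the anchor flows (K1, the remaining port).  STANDALONE, IMPORTABLE DUPLICATE: the line file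
`Lines/chiral_anchor.lean` REV4 (commit 2666995f3537) carries the SAME proof inlined (namespace `…ChiralAnchor.K4`, closing its registered stub
`stub_anchorRace` in-file) and does NOT import this module; this module exists so that the LEAD or another line can `import` the race without the 43
LEAD predicates of the line file (module `…Cruxes.PowerGaugeEulerLiouville.ChiralAnchorK4`; the nine definitions below are SYNTACTICALLY IDENTICAL copies —
checked by script, 9/9, whitespace-normalised — of the line file's `E3`, `InClass`, `ShellHelicityFloor`, `IsAnchorFlow`, `FarVolumeBound`, `IsTubeDatum`,
`tubeHelicity`, `IsChiralTubePast`, `IsTubeTransport`, `HasAnchorFlows`, hence definitionally equal to them, so `ChiralAnchorK4.anchorRace` applies to the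
line's hypotheses by unfolding; it imports neither `Lines.birth` nor the line file).

## The proof (eight proved helpers + assembly)
(1) `pigeonhole_sq_weights`: `Σ_{j<J} h_j = H ≠ 0 ⇒ ∃ j < J, |H|/(4(j+1)²) ≤ |h_j|` (finite, `Σ 1/(j+1)² ≤ 2`, no Basel constant);
(2) `floor_dichotomy` (algebra: `η ≤ K(G² + mG)` ⇒ `G² ≥ min(η/2K, η²/(4K²m²))`); (3) `exponent_race`: `K₁A^{1−ρ} + K₂A^{2−2ρ} + K₃A^{2−5ρ} < A²` for
`A ≥ A₀(ρ,K)`, every `ρ > 0`; (4) `memberShellFloor`: K2 + `‖curl v‖² ≤ 16‖∇v‖_F²` (`SwirlfreeLedger.sq_norm_curl_le_frobeniusNormSq`) + the `A`-gauge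
(`Backward.lintegral_ball_le_of_gaugeA`) + (2) ⇒ for a member, a slice `s ∈ (−R², 0)`, a weight `|w| ≤ 1` vanishing off a set `T` of volume `≤ V` and
`η ≤ |∫_{B_R} w⟪u(s), curl u(s)⟫|`: `min(η/(C₁V^{1/3}), η²R^{1+2ρ}/(C₁cV^{2/3})) ≤ ∫_{B_R}‖∇u(s)‖_F²` (`C₁ = 64(C+1)²`); (5) `farLabelVolume`: K3 packaged for
windows of length `≤ A²` and scales `R ≥ max(2R₀, A)`: `vol{y ∈ T : ‖X_s y‖ ≥ R} ≤ (C₂cA²R^{−(1+ρ)})³`; (6) `windowBudget`: the `E`-gauge sliced in time,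
`∫⁻_{(−a²,0)} ofReal(∫_{B_a}‖∇u(s)‖_F²) ≤ ofReal(c a^{1−ρ})` with a.e.-measurability (`SwirlfreeLedger.setLIntegral_window_frobenius_fderiv_le`, Tonelli);
(7) `raceSeries`: with `e_j = min(η_j/(C₁V_j^{1/3}), η_j²R_j^{1+2ρ}/(C₁cV_j^{2/3}))`, `η_j = |H|/(4(j+1)²)`, `R_j = 2^{j+1}A`, `V_0 = v₀`,
`V_{j+1} = (C₂cA²R_{j+1}^{−(1+ρ)})³`: `Σ_{j<J} cR_j^{1−ρ}/e_j ≤ K₁A^{1−ρ} + K₂A^{2−2ρ} + K₃A^{2−5ρ}` with `K`'s free of `A, J` (geometric tails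
`Σ(i+2)^k r^{i+1}`, `summable_shift_sq_geometric`); (8) `hostingShell`: the dyadic shells `shellSet A j` (core ball `j = 0`) partition `B(0,2^J A)`, so
`∫χg = Σ_{j<J}∫𝟙_{shell j}χg` (`integral_finsetSum`) and (1) picks a hosting shell.  ASSEMBLY `anchorRace`: `L = {χ ≠ 0}` is open, non-empty (else
`H = 0`), `v₀ = vol L ∈ (0,∞)`; `c > 0` (else the `A`-gauge makes `u(t₀) = 0` a.e. on a ball containing the tube, so `H = 0`); `A = max(A₀, R₀, √(−t₀)+1)`,
window `(t₀−A², t₀)`, anchor flow `X` + transported cut-offs `χ'` from `HasAnchorFlows`, `J` with `R' ≤ 2^J A`; at each `s` in the window the hosting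
shell `j < J` of `χ'_s` and (4) — with label set `E = L` (`j = 0`) or `E = {y ∈ L : 2^jA ≤ ‖X_s y‖}` (`j ≥ 1`, volume by (5), image measurable with equal
volume by the anchor-flow clauses) — give `e_j ≤ F_j(s) = ∫_{B_{R_j}}‖∇u(s)‖_F²`, hence POINTWISE `1 ≤ Σ_{j<J} F_j(s)/e_j` in `ℝ≥0∞`; integrating
(`lintegral_finsetSum'`, (6), (7)) `A² ≤ K₁A^{1−ρ} + K₂A^{2−2ρ} + K₃A^{2−5ρ}`, contradicting (3).  No hosting sets, no measurable selection, no
`D`-gauge, no local energy inequality, no `ρ ≤ ½`.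
-/

noncomputable section

open MeasureTheory Set Filter Topology Metric
open scoped ENNReal NNReal ContDiff

set_option linter.dupNamespace false

namespace Summit.NavierStokesRegularity.NavierStokesRegularity.Cruxes.PowerGaugeEulerLiouville.ChiralAnchorK4

/-! ### Verbatim copies (9/9 identical to `Lines/chiral_anchor.lean`, docstrings dropped) of the definitions the race is stated over -/


abbrev E3 : Type := EuclideanSpace ℝ (Fin 3)

@[reducible] def InClass (ρ : ℝ) (u : ℝ → E3 → E3) (p : ℝ → E3 → ℝ) (H : ℝ → E3 → E3 →L[ℝ] E3)
    (c : ℝ≥0) : Prop :=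
  Literature.Analysis.FluidPDE.IsSuitableWeakSolutionOn
      (Literature.Analysis.FluidPDE.slab (EuclideanSpace ℝ (Fin 3)) (Set.Iio 0) isOpen_Iio) 0 0 u p ∧
    Literature.Analysis.FluidPDE.HasWeakSpatialGradientOn
      (Literature.Analysis.FluidPDE.slab (EuclideanSpace ℝ (Fin 3)) (Set.Iio 0) isOpen_Iio) u H ∧
    (∀ a : ℝ, 0 < a →
      ENNReal.ofReal (a ^ (2 * ρ)) * Literature.Analysis.FluidPDE.cknA a (0 : ℝ × E3) u +
          ENNReal.ofReal (a ^ ρ) * Literature.Analysis.FluidPDE.cknE a (0 : ℝ × E3) H +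
        ENNReal.ofReal (a ^ (2 * ρ)) * Literature.Analysis.FluidPDE.cknD a (0 : ℝ × E3) p ≤ (c : ℝ≥0∞))

def ShellHelicityFloor : Prop :=
  ∃ C : ℝ, 0 < C ∧ ∀ R : ℝ, 0 < R → ∀ v : E3 → E3, ContDiff ℝ 1 v →
    ∀ w : E3 → ℝ, Measurable w → (∀ x : E3, |w x| ≤ 1) →
      ∀ T : Set E3, MeasurableSet T → volume T < ⊤ → (∀ x : E3, x ∉ T → w x = 0) →
        |∫ x in Metric.ball (0 : E3) R, w x * inner ℝ (v x) (Literature.Analysis.FluidPDE.curl v x)| ≤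
          C * (volume T).toReal ^ (1 / 3 : ℝ) *
              (Real.sqrt (∫ x in Metric.ball (0 : E3) R, ‖fderiv ℝ v x‖ ^ 2) +
                R⁻¹ * Real.sqrt (∫ x in Metric.ball (0 : E3) R, ‖v x‖ ^ 2)) *
            Real.sqrt (∫ x in Metric.ball (0 : E3) R, ‖Literature.Analysis.FluidPDE.curl v x‖ ^ 2)


def IsAnchorFlow (u : ℝ → E3 → E3) (t₁ t₀ : ℝ) (T : Set E3) (X : ℝ → E3 → E3) : Prop :=
  Continuous (fun q : ℝ × E3 => X q.1 q.2) ∧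
    (∀ y ∈ T, X t₀ y = y) ∧
    (∀ r ∈ Set.Icc t₁ t₀, ∀ y ∈ T, HasDerivWithinAt (fun σ : ℝ => X σ y) (u r (X r y)) (Set.Icc t₁ t₀) r) ∧
    (∀ r ∈ Set.Icc t₁ t₀, Set.InjOn (X r) T) ∧
    (∀ r ∈ Set.Icc t₁ t₀, ∀ S ⊆ T, MeasurableSet S → MeasurableSet (X r '' S) ∧ volume (X r '' S) = volume S) ∧
    (∀ r ∈ Set.Icc t₁ t₀, ∀ S ⊆ T, MeasurableSet S → ∀ g : E3 → ℝ≥0∞, Measurable g →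
      ∫⁻ x in X r '' S, g x = ∫⁻ y in S, g (X r y)) ∧
    (∃ R' : ℝ, ∀ r ∈ Set.Icc t₁ t₀, X r '' T ⊆ Metric.ball (0 : E3) R')

def FarVolumeBound : Prop :=
  ∃ C : ℝ, 0 < C ∧ ∀ ρ : ℝ, 0 < ρ →
    ∀ (u : ℝ → E3 → E3) (p : ℝ → E3 → ℝ) (H : ℝ → E3 → E3 →L[ℝ] E3) (c : ℝ≥0), InClass ρ u p H c →
      Literature.Analysis.FluidPDE.IsClassicalEulerSolutionOn (Set.Iio 0) 0 u p →
        ∀ (t₁ t₀ : ℝ) (T : Set E3) (X : ℝ → E3 → E3), t₁ < t₀ → t₀ < 0 → MeasurableSet T → IsAnchorFlow u t₁ t₀ T X →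
          ∀ R₀ : ℝ, 0 < R₀ → T ⊆ Metric.ball (0 : E3) R₀ →
            ∀ R : ℝ, 2 * R₀ ≤ R → -R ^ 2 < t₁ →
              ∀ s ∈ Set.Icc t₁ t₀, ∀ E₀ ⊆ T, MeasurableSet E₀ → (∀ y ∈ E₀, R ≤ ‖X s y‖) →
                (volume E₀).toReal ^ (1 / 6 : ℝ) * (R - R₀) ≤
                  C * Real.sqrt (c : ℝ) * (Real.sqrt (t₀ - s) * R ^ ((1 - ρ) / 2) + (t₀ - s) * R ^ (-(1 / 2 + ρ)))

@[reducible] def IsTubeDatum (v : E3 → E3) (χ : E3 → ℝ) (R : ℝ) : Prop :=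
  ContDiff ℝ ∞ χ ∧ (∀ x : E3, |χ x| ≤ 1) ∧ (∀ x : E3, R ≤ ‖x‖ → χ x = 0) ∧
    ∀ x : E3, fderiv ℝ χ x (Literature.Analysis.FluidPDE.curl v x) = 0

def tubeHelicity (v : E3 → E3) (χ : E3 → ℝ) : ℝ :=
  ∫ x, χ x * inner ℝ (v x) (Literature.Analysis.FluidPDE.curl v x)

@[reducible] def IsChiralTubePast (u : ℝ → E3 → E3) (p : ℝ → E3 → ℝ) : Prop :=
  Literature.Analysis.FluidPDE.IsClassicalEulerSolutionOn (Set.Iio 0) 0 u p ∧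
    ∃ t₀ : ℝ, t₀ < 0 ∧
      (∀ t₁ : ℝ, t₁ < t₀ → ∃ B : ℝ, ∀ r ∈ Set.Icc t₁ t₀, ∀ x : E3, ‖u r x‖ ≤ B) ∧
      ∃ (χ : E3 → ℝ) (R : ℝ), 0 < R ∧
        (ContDiff ℝ ∞ χ ∧ (∀ x : E3, |χ x| ≤ 1) ∧ (∀ x : E3, R ≤ ‖x‖ → χ x = 0) ∧
          ∀ x : E3, fderiv ℝ χ x (Literature.Analysis.FluidPDE.curl (u t₀) x) = 0) ∧
        (∫ x, χ x * inner ℝ (u t₀ x) (Literature.Analysis.FluidPDE.curl (u t₀) x)) ≠ 0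

def IsTubeTransport (u : ℝ → E3 → E3) (t₁ t₀ : ℝ) (T : Set E3) (χ : E3 → ℝ) (X : ℝ → E3 → E3) (χ' : ℝ → E3 → ℝ) : Prop :=
  χ' t₀ = χ ∧
    ∀ r ∈ Set.Icc t₁ t₀,
      (∃ R' : ℝ, 0 < R' ∧ IsTubeDatum (u r) (χ' r) R') ∧
        (∀ y ∈ T, χ' r (X r y) = χ y) ∧
        (∀ x : E3, χ' r x ≠ 0 → x ∈ X r '' T) ∧
        tubeHelicity (u r) (χ' r) = tubeHelicity (u t₀) χ

def HasAnchorFlows (u : ℝ → E3 → E3) : Prop :=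
  ∀ t₀ : ℝ, t₀ < 0 → ∀ t₁ : ℝ, t₁ < t₀ →
    (∃ B : ℝ, ∀ r ∈ Set.Icc t₁ t₀, ∀ x : E3, ‖u r x‖ ≤ B) →
      ∀ (χ : E3 → ℝ) (R : ℝ), 0 < R → IsTubeDatum (u t₀) χ R →
        ∃ (X : ℝ → E3 → E3) (χ' : ℝ → E3 → ℝ),
          IsAnchorFlow u t₁ t₀ {x : E3 | χ x ≠ 0} X ∧ IsTubeTransport u t₁ t₀ {x : E3 | χ x ≠ 0} χ X χ'

/-! ### K4 helper 1: pigeonhole with square weights (finite range; no Basel constant needed) -/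

theorem sum_range_inv_succ_sq_le_two (J : ℕ) : ∑ j ∈ Finset.range J, ((j + 1 : ℝ) ^ 2)⁻¹ ≤ 2 := by
  have h := sum_Ioo_inv_sq_le (α := ℝ) 0 (J + 1)
  have e : ∑ j ∈ Finset.range J, ((j + 1 : ℝ) ^ 2)⁻¹ = ∑ i ∈ Finset.Ioo 0 (J + 1), ((i : ℝ) ^ 2)⁻¹ := by
    have hI : Finset.Ioo 0 (J + 1) = Finset.image (fun j => j + 1) (Finset.range J) := by
      ext i
      simp only [Finset.mem_Ioo, Finset.mem_image, Finset.mem_range]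
      constructor
      · rintro ⟨h1, h2⟩; exact ⟨i - 1, by omega, by omega⟩
      · rintro ⟨j, hj, rfl⟩; exact ⟨by omega, by omega⟩
    rw [hI, Finset.sum_image (fun a _ b _ h => by simpa using h)]
    simp
  rw [e]
  simpa using h

/-- **Pigeonhole with square weights**: if finitely many reals `h j` (`j < J`) sum to `H ≠ 0`, some `|h j| ≥ |H| / (4 (j+1)²)`. -/
theorem pigeonhole_sq_weights (h : ℕ → ℝ) {H : ℝ} (hH : H ≠ 0) {J : ℕ}
    (hsum : ∑ j ∈ Finset.range J, h j = H) : ∃ j, j < J ∧ |H| / (4 * (j + 1 : ℝ) ^ 2) ≤ |h j| := by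
  by_contra hcon
  push Not at hcon
  have hlt : ∀ j ∈ Finset.range J, |h j| < |H| / (4 * (j + 1 : ℝ) ^ 2) := fun j hj =>
    hcon j (Finset.mem_range.1 hj)
  have hHpos : 0 < |H| := abs_pos.2 hH
  have h1 : |H| ≤ ∑ j ∈ Finset.range J, |h j| := by
    rw [← hsum]; exact Finset.abs_sum_le_sum_abs _ _
  have h2 : ∑ j ∈ Finset.range J, |h j| ≤ ∑ j ∈ Finset.range J, |H| / (4 * (j + 1 : ℝ) ^ 2) :=
    Finset.sum_le_sum fun j hj => (hlt j hj).le
  have h3 : ∑ j ∈ Finset.range J, |H| / (4 * (j + 1 : ℝ) ^ 2) = |H| / 4 * ∑ j ∈ Finset.range J, ((j + 1 : ℝ) ^ 2)⁻¹ := by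
    rw [Finset.mul_sum]
    refine Finset.sum_congr rfl fun j _ => ?_
    field_simp
  have h4 := sum_range_inv_succ_sq_le_two J
  have : |H| ≤ |H| / 4 * 2 := by
    calc |H| ≤ _ := h1
      _ ≤ _ := h2
      _ = _ := h3
      _ ≤ |H| / 4 * 2 := mul_le_mul_of_nonneg_left h4 (by positivity)
  linarith

/-! ### K4 helper 2: the floor dichotomy (pure algebra of the shell helicity floor + the `A`-gauge) -/

/-- **Floor dichotomy**: if `η ≤ K (G² + m G)` with `η, K > 0`, `m ≥ 0`, `G ≥ 0` (K2's floor after `‖curl v‖ ≤ √2‖∇v‖`, with `m = ‖v‖_{L²}/R`),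
then `G² ≥ min (η/(2K)) (η²/(4 K² m²))` — read with the convention that the second entry is only used when `m > 0`. -/
theorem floor_dichotomy {η K m G : ℝ} (hη : 0 < η) (hK : 0 < K) (hm : 0 ≤ m) (hG : 0 ≤ G)
    (h : η ≤ K * (G ^ 2 + m * G)) :
    η / (2 * K) ≤ G ^ 2 ∨ (0 < m ∧ η ^ 2 / (4 * K ^ 2 * m ^ 2) ≤ G ^ 2) := by
  rcases le_or_gt m G with hmG | hmG
  · -- `m ≤ G`: `η ≤ K (G² + G²) = 2 K G²`
    left
    rw [div_le_iff₀ (by positivity)]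
    have h1 : m * G ≤ G ^ 2 := by nlinarith
    nlinarith [mul_le_mul_of_nonneg_left h1 hK.le]
  · -- `G < m`: `η ≤ K (m G + m G) = 2 K m G`, so `η² ≤ 4 K² m² G²`
    right
    have hm0 : 0 < m := lt_of_le_of_lt hG hmG
    refine ⟨hm0, ?_⟩
    rw [div_le_iff₀ (by positivity)]
    have h1 : η ≤ 2 * K * m * G := by nlinarith
    have h2 : 0 ≤ 2 * K * m * G := by positivity
    nlinarith [mul_le_mul h1 h1 hη.le h2]

/-! ### K4 helper 3: the exponent race (every `ρ > 0`) -/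

/-- **Exponent race**: for `ρ > 0` and any constants, `K₁ A^{1−ρ} + K₂ A^{2−2ρ} + K₃ A^{2−5ρ} < A²` for all large `A`. -/
theorem exponent_race {ρ : ℝ} (hρ : 0 < ρ) (K₁ K₂ K₃ : ℝ) :
    ∃ A₀ : ℝ, 1 ≤ A₀ ∧ ∀ A : ℝ, A₀ ≤ A →
      K₁ * A ^ (1 - ρ) + K₂ * A ^ (2 - 2 * ρ) + K₃ * A ^ (2 - 5 * ρ) < A ^ 2 := by
  -- `f(A) = K₁ A^{-(1+ρ)} + K₂ A^{-(2ρ)} + K₃ A^{-(5ρ)} → 0`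
  have hf : Tendsto (fun A : ℝ => K₁ * A ^ (-(1 + ρ)) + K₂ * A ^ (-(2 * ρ)) + K₃ * A ^ (-(5 * ρ))) atTop (𝓝 0) := by
    have h1 := (tendsto_rpow_neg_atTop (y := 1 + ρ) (by linarith)).const_mul K₁
    have h2 := (tendsto_rpow_neg_atTop (y := 2 * ρ) (by linarith)).const_mul K₂
    have h3 := (tendsto_rpow_neg_atTop (y := 5 * ρ) (by linarith)).const_mul K₃
    simpa using (h1.add h2).add h3
  have hev : ∀ᶠ A : ℝ in atTop, K₁ * A ^ (-(1 + ρ)) + K₂ * A ^ (-(2 * ρ)) + K₃ * A ^ (-(5 * ρ)) < 1 :=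
    hf (Iio_mem_nhds zero_lt_one)
  obtain ⟨A₁, hA₁⟩ := (hev.and (eventually_ge_atTop 1)).exists_forall_of_atTop
  refine ⟨max A₁ 1, le_max_right _ _, fun A hA => ?_⟩
  have hA1 : 1 ≤ A := (le_max_right _ _).trans hA
  have hA0 : 0 < A := lt_of_lt_of_le zero_lt_one hA1
  obtain ⟨hlt, -⟩ := hA₁ A ((le_max_left _ _).trans hA)
  have hA2 : 0 < A ^ 2 := by positivity
  have e1 : A ^ (1 - ρ) = A ^ (-(1 + ρ)) * A ^ 2 := by
    rw [← Real.rpow_natCast A 2, ← Real.rpow_add hA0]; norm_num; ring_nf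
  have e2 : A ^ (2 - 2 * ρ) = A ^ (-(2 * ρ)) * A ^ 2 := by
    rw [← Real.rpow_natCast A 2, ← Real.rpow_add hA0]; norm_num; ring_nf
  have e3 : A ^ (2 - 5 * ρ) = A ^ (-(5 * ρ)) * A ^ 2 := by
    rw [← Real.rpow_natCast A 2, ← Real.rpow_add hA0]; norm_num; ring_nf
  rw [e1, e2, e3]
  have := mul_lt_mul_of_pos_right hlt hA2
  linarith [this]


/-! ### K4 helper 4: the MEMBER SHELL FLOOR (K2 + `‖curl v‖² ≤ 16‖∇v‖_F²` + the `A`-gauge + the floor dichotomy) -/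

open Literature.Analysis Literature.Analysis.FluidPDE
open Summit.NavierStokesRegularity.NavierStokesRegularity.Theorems.PowerGaugeEulerLiouville

/-- **Member shell floor**: for a member of the class (any `ρ > 0`, classical), a ball `B_R`, a slice `s ∈ (−R², 0)` and a weight `|w| ≤ 1` vanishing
off a measurable set `T` of finite volume `≤ V`: if the weighted helicity `|∫_{B_R} w⟪u(s), curl u(s)⟫| ≥ η > 0`, then
`∫_{B_R} ‖∇u(s)‖_F² ≥ min (η/(C₁ V^{1/3})) (η² R^{1+2ρ}/(C₁ c V^{2/3}))` (the bound is ANTITONE in `V`, so any upper bound `V` for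
`vol T` may be fed — e.g. the far-label volume bound; Lean's `x/0 = 0` makes the degenerate case `c = 0` vacuous-true). -/
theorem memberShellFloor (hK2 : ShellHelicityFloor) :
    ∃ C₁ : ℝ, 0 < C₁ ∧ ∀ ρ : ℝ, 0 < ρ →
      ∀ (u : ℝ → E3 → E3) (p : ℝ → E3 → ℝ) (H : ℝ → E3 → E3 →L[ℝ] E3) (c : ℝ≥0), InClass ρ u p H c →
        IsClassicalEulerSolutionOn (Set.Iio 0) 0 u p →
          ∀ R : ℝ, 0 < R → ∀ s ∈ Set.Ioo (-(R ^ 2)) 0, ∀ w : E3 → ℝ, Measurable w → (∀ x : E3, |w x| ≤ 1) →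
            ∀ T : Set E3, MeasurableSet T → volume T < ⊤ → (∀ x : E3, x ∉ T → w x = 0) →
              ∀ V : ℝ, (volume T).toReal ≤ V →
              ∀ η : ℝ, 0 < η → η ≤ |∫ x in Metric.ball (0 : E3) R, w x * inner ℝ (u s x) (curl (u s) x)| →
                min (η / (C₁ * V ^ (1 / 3 : ℝ)))
                    (η ^ 2 * R ^ (1 + 2 * ρ) / (C₁ * (c : ℝ) * V ^ (2 / 3 : ℝ))) ≤
                  ∫ x in Metric.ball (0 : E3) R, frobeniusNormSq (fderiv ℝ (u s) x) := by
  obtain ⟨C, hC, hK⟩ := hK2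
  refine ⟨64 * (C + 1) ^ 2, by positivity, ?_⟩
  intro ρ hρ u p H c hcls hcl R hR s hs w hwm hw1 T hT hTfin hwT V hTV η hη hηle
  obtain ⟨_, hH, hgauge⟩ := hcls
  have hA : ENNReal.ofReal (R ^ (2 * ρ)) * cknA R (0 : ℝ × E3) u ≤ (c : ℝ≥0∞) :=
    le_trans (le_trans le_self_add le_self_add) (hgauge R hR)
  have hs0 : s ∈ Set.Iio (0 : ℝ) := hs.2
  have hv : ContDiff ℝ 1 (u s) := (hcl.contDiff_velocity hs0).of_le (by norm_cast)
  have hvc : Continuous (u s) := hv.continuous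
  have hDc : Continuous (fderiv ℝ (u s)) := hv.continuous_fderiv one_ne_zero
  have hcurlc : Continuous (curl (u s)) := by
    rw [curl_eq_curlCLM_comp]; exact curlCLM.continuous.comp hDc
  have hFc : Continuous fun x => frobeniusNormSq (fderiv ℝ (u s) x) := continuous_frobeniusNormSq_fderiv hv one_ne_zero
  set B : Set E3 := Metric.ball (0 : E3) R with hBdef
  set V₀ : ℝ := (volume T).toReal with hV₀def
  have hV₀0 : 0 ≤ V₀ := ENNReal.toReal_nonneg
  have hV0 : 0 ≤ V := hV₀0.trans hTV
  set F : ℝ := ∫ x in B, frobeniusNormSq (fderiv ℝ (u s) x) with hFdef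
  have hF0 : 0 ≤ F := integral_nonneg fun x => frobeniusNormSq_nonneg _
  -- integrability on the ball of the continuous integrands
  have hint : ∀ {g : E3 → ℝ}, Continuous g → IntegrableOn g B volume := fun hg =>
    (hg.continuousOn.integrableOn_compact (isCompact_closedBall (0 : E3) R)).mono_set ball_subset_closedBall
  -- (a) `∫‖∇v‖² ≤ F` and `∫‖curl v‖² ≤ 16 F`
  have hD_le : ∫ x in B, ‖fderiv ℝ (u s) x‖ ^ 2 ≤ F :=
    integral_mono (hint (hDc.norm.pow 2)) (hint hFc) fun x => sq_opNorm_le_frobeniusNormSq _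
  have hcurl_le : ∫ x in B, ‖curl (u s) x‖ ^ 2 ≤ 16 * F := by
    calc ∫ x in B, ‖curl (u s) x‖ ^ 2 ≤ ∫ x in B, 16 * frobeniusNormSq (fderiv ℝ (u s) x) :=
          integral_mono (hint (hcurlc.norm.pow 2)) ((hint hFc).const_mul 16) fun x =>
            SwirlfreeLedger.sq_norm_curl_le_frobeniusNormSq _ _
      _ = 16 * F := integral_const_mul _ _
  -- (b) the `A`-gauge in real form
  have hM_le : ∫ x in B, ‖u s x‖ ^ 2 ≤ (c : ℝ) * R ^ (1 - 2 * ρ) := by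
    have h1 := Backward.lintegral_ball_le_of_gaugeA (u := u) hR hA hs
    have h2 : ∫⁻ x in B, ‖u s x‖ₑ ^ 2 = ENNReal.ofReal (∫ x in B, ‖u s x‖ ^ 2) := by
      rw [ofReal_integral_eq_lintegral_ofReal (hint (g := fun x => ‖u s x‖ ^ 2) (hvc.norm.pow 2))
          (ae_of_all _ fun x => sq_nonneg _)]
      refine lintegral_congr fun x => ?_
      rw [← ofReal_norm, ENNReal.ofReal_pow (norm_nonneg _)]
    rw [← hBdef, h2] at h1
    exact (ENNReal.ofReal_le_ofReal_iff (mul_nonneg c.coe_nonneg (Real.rpow_nonneg hR.le _))).1 h1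
  -- (c) square roots
  set G : ℝ := Real.sqrt F with hGdef
  have hG0 : 0 ≤ G := Real.sqrt_nonneg _
  have hGsq : G ^ 2 = F := Real.sq_sqrt hF0
  have hGD : Real.sqrt (∫ x in B, ‖fderiv ℝ (u s) x‖ ^ 2) ≤ G := Real.sqrt_le_sqrt hD_le
  have hGc : Real.sqrt (∫ x in B, ‖curl (u s) x‖ ^ 2) ≤ 4 * G := by
    calc Real.sqrt (∫ x in B, ‖curl (u s) x‖ ^ 2) ≤ Real.sqrt (16 * F) := Real.sqrt_le_sqrt hcurl_le
      _ = 4 * G := by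
          rw [Real.sqrt_mul (by norm_num), show (16 : ℝ) = 4 ^ 2 by norm_num, Real.sqrt_sq (by norm_num)]
  set M : ℝ := Real.sqrt (∫ x in B, ‖u s x‖ ^ 2) with hMdef
  have hM0 : 0 ≤ M := Real.sqrt_nonneg _
  have hMsq : M ^ 2 ≤ (c : ℝ) * R ^ (1 - 2 * ρ) := by
    rw [hMdef, Real.sq_sqrt (integral_nonneg fun x => by positivity)]; exact hM_le
  -- (d) K2
  have hK2' := hK R hR (u s) hv w hwm hw1 T hT hTfin hwT
  rw [← hBdef, ← hV₀def, ← hMdef] at hK2'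
  have hRinvM : 0 ≤ R⁻¹ * M := mul_nonneg (inv_nonneg.2 hR.le) hM0
  have hfac0 : 0 ≤ (Real.sqrt (∫ x in B, ‖fderiv ℝ (u s) x‖ ^ 2) + R⁻¹ * M) *
      Real.sqrt (∫ x in B, ‖curl (u s) x‖ ^ 2) :=
    mul_nonneg (add_nonneg (Real.sqrt_nonneg _) hRinvM) (Real.sqrt_nonneg _)
  by_cases hVz : V₀ = 0
  · -- `vol T = 0`: K2 gives `|∫…| ≤ 0`, contradicting `η > 0`
    exfalso
    have : |∫ x in B, w x * inner ℝ (u s x) (curl (u s) x)| ≤ 0 := by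
      calc _ ≤ _ := hK2'
        _ = 0 := by rw [hVz, Real.zero_rpow (by norm_num)]; ring
    linarith [abs_nonneg (∫ x in B, w x * inner ℝ (u s x) (curl (u s) x))]
  have hV₀pos : 0 < V₀ := lt_of_le_of_ne hV₀0 (Ne.symm hVz)
  have hVpos : 0 < V := lt_of_lt_of_le hV₀pos hTV
  have hV13 : 0 < V ^ (1 / 3 : ℝ) := Real.rpow_pos_of_pos hVpos _
  have hV13le : V₀ ^ (1 / 3 : ℝ) ≤ V ^ (1 / 3 : ℝ) := Real.rpow_le_rpow hV₀0 hTV (by norm_num)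
  set K : ℝ := 4 * C * V ^ (1 / 3 : ℝ) with hKdef
  have hKpos : 0 < K := by positivity
  have hmain : η ≤ K * (G ^ 2 + M / R * G) := by
    calc η ≤ |∫ x in B, w x * inner ℝ (u s x) (curl (u s) x)| := hηle
      _ ≤ C * V₀ ^ (1 / 3 : ℝ) *
            (Real.sqrt (∫ x in B, ‖fderiv ℝ (u s) x‖ ^ 2) + R⁻¹ * M) * Real.sqrt (∫ x in B, ‖curl (u s) x‖ ^ 2) := hK2'
      _ ≤ C * V ^ (1 / 3 : ℝ) *
            (Real.sqrt (∫ x in B, ‖fderiv ℝ (u s) x‖ ^ 2) + R⁻¹ * M) * Real.sqrt (∫ x in B, ‖curl (u s) x‖ ^ 2) := by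
          rw [mul_assoc, mul_assoc, mul_assoc, mul_assoc]
          exact mul_le_mul_of_nonneg_left (mul_le_mul_of_nonneg_right hV13le hfac0) hC.le
      _ ≤ C * V ^ (1 / 3 : ℝ) * (G + R⁻¹ * M) * (4 * G) := by
          have h0 : 0 ≤ C * V ^ (1 / 3 : ℝ) := by positivity
          have h1 : 0 ≤ Real.sqrt (∫ x in B, ‖fderiv ℝ (u s) x‖ ^ 2) + R⁻¹ * M :=
            add_nonneg (Real.sqrt_nonneg _) hRinvM
          have h2 : Real.sqrt (∫ x in B, ‖fderiv ℝ (u s) x‖ ^ 2) + R⁻¹ * M ≤ G + R⁻¹ * M := by linarith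
          exact mul_le_mul (mul_le_mul_of_nonneg_left h2 h0) hGc (Real.sqrt_nonneg _)
            (mul_nonneg h0 (le_trans h1 h2))
      _ = K * (G ^ 2 + M / R * G) := by rw [hKdef]; ring
  rcases floor_dichotomy hη hKpos (div_nonneg hM0 hR.le) hG0 hmain with h1 | ⟨hmpos, h2⟩
  · -- first branch: `η/(2K) ≤ F`
    refine min_le_of_left_le (le_trans ?_ (h1.trans_eq hGsq))
    rw [hKdef]
    apply div_le_div_of_nonneg_left hη.le (by positivity)
    nlinarith [hV13, hC]
  · -- second branch: `M > 0`, so `c > 0`, and `η²/(4K²(M/R)²) ≤ F`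
    have hMpos : 0 < M := by
      by_contra h
      push Not at h
      have hM00 : M = 0 := le_antisymm h hM0
      rw [hM00, zero_div] at hmpos
      exact lt_irrefl _ hmpos
    have hcpos : 0 < (c : ℝ) := by
      by_contra h
      push Not at h
      have hc0 : (c : ℝ) = 0 := le_antisymm h c.coe_nonneg
      rw [hc0, zero_mul] at hMsq
      nlinarith [hMpos]
    have hV23 : (V ^ (1 / 3 : ℝ)) ^ 2 = V ^ (2 / 3 : ℝ) := by
      rw [← Real.rpow_natCast, ← Real.rpow_mul hV0]; norm_num
    have hV23pos : 0 < V ^ (2 / 3 : ℝ) := Real.rpow_pos_of_pos hVpos _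
    have hR2 : R ^ (1 + 2 * ρ) * R ^ (1 - 2 * ρ) = R ^ 2 := by
      rw [← Real.rpow_add hR, show (1 + 2 * ρ) + (1 - 2 * ρ) = (2 : ℝ) by ring, Real.rpow_two]
    have hRpow : 0 < R ^ (1 + 2 * ρ) := Real.rpow_pos_of_pos hR _
    have hkey : 4 * K ^ 2 * (M / R) ^ 2 * R ^ (1 + 2 * ρ) ≤ 64 * (C + 1) ^ 2 * (c : ℝ) * V ^ (2 / 3 : ℝ) := by
      calc 4 * K ^ 2 * (M / R) ^ 2 * R ^ (1 + 2 * ρ)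
          = 64 * C ^ 2 * V ^ (2 / 3 : ℝ) * M ^ 2 * (R ^ (1 + 2 * ρ) / R ^ 2) := by
            rw [hKdef, div_pow, ← hV23]; ring
        _ ≤ 64 * C ^ 2 * V ^ (2 / 3 : ℝ) * ((c : ℝ) * R ^ (1 - 2 * ρ)) * (R ^ (1 + 2 * ρ) / R ^ 2) := by
            gcongr
        _ = 64 * C ^ 2 * (c : ℝ) * V ^ (2 / 3 : ℝ) * ((R ^ (1 + 2 * ρ) * R ^ (1 - 2 * ρ)) / R ^ 2) := by ring
        _ = 64 * C ^ 2 * (c : ℝ) * V ^ (2 / 3 : ℝ) := by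
            rw [hR2, div_self (pow_ne_zero 2 hR.ne'), mul_one]
        _ ≤ 64 * (C + 1) ^ 2 * (c : ℝ) * V ^ (2 / 3 : ℝ) := by
            have hC1 : C ^ 2 ≤ (C + 1) ^ 2 := pow_le_pow_left₀ hC.le (by linarith) 2
            exact mul_le_mul_of_nonneg_right (mul_le_mul_of_nonneg_right
              (mul_le_mul_of_nonneg_left hC1 (by norm_num)) c.coe_nonneg) hV23pos.le
    refine min_le_of_right_le ?_
    have hden : 0 < 4 * K ^ 2 * (M / R) ^ 2 * R ^ (1 + 2 * ρ) :=
      mul_pos (mul_pos (mul_pos (by norm_num) (pow_pos hKpos 2)) (pow_pos hmpos 2)) hRpow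
    have hnum : 0 ≤ η ^ 2 * R ^ (1 + 2 * ρ) := mul_nonneg (sq_nonneg _) hRpow.le
    calc η ^ 2 * R ^ (1 + 2 * ρ) / (64 * (C + 1) ^ 2 * (c : ℝ) * V ^ (2 / 3 : ℝ))
        ≤ η ^ 2 * R ^ (1 + 2 * ρ) / (4 * K ^ 2 * (M / R) ^ 2 * R ^ (1 + 2 * ρ)) :=
          div_le_div_of_nonneg_left hnum hden hkey
      _ = η ^ 2 / (4 * K ^ 2 * (M / R) ^ 2) := by rw [mul_div_mul_right _ _ hRpow.ne']
      _ ≤ G ^ 2 := h2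
      _ = F := hGsq

/-! ### K4 helper 5: the FAR-LABEL VOLUME bound (K3 packaged for the race: window length `≤ A²`, scale `R ≥ max (2R₀) A`, `A ≥ 1`) -/

/-- **Far-label volume**: along an anchor flow of a label set `T ⊆ B(0,R₀)` on a window `[t₁,t₀]` of length `≤ A²` (`A ≥ 1`), at every time `s` the
labels sent beyond radius `R ≥ max (2R₀) A` (with `−R² < t₁`) form a measurable set of volume `≤ (C₂ c A² R^{−(1+ρ)})³` (cubed form: its
`1/3` and `2/3` powers, which the member shell floor consumes, are then polynomial). -/
theorem farLabelVolume (hK3 : FarVolumeBound) :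
    ∃ C₂ : ℝ, 0 < C₂ ∧ ∀ ρ : ℝ, 0 < ρ →
      ∀ (u : ℝ → E3 → E3) (p : ℝ → E3 → ℝ) (H : ℝ → E3 → E3 →L[ℝ] E3) (c : ℝ≥0), InClass ρ u p H c →
        IsClassicalEulerSolutionOn (Set.Iio 0) 0 u p →
          ∀ (t₁ t₀ : ℝ) (T : Set E3) (X : ℝ → E3 → E3), t₁ < t₀ → t₀ < 0 → MeasurableSet T → IsAnchorFlow u t₁ t₀ T X →
            ∀ R₀ : ℝ, 0 < R₀ → T ⊆ Metric.ball (0 : E3) R₀ →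
              ∀ A : ℝ, 1 ≤ A → t₀ - t₁ ≤ A ^ 2 →
                ∀ R : ℝ, 2 * R₀ ≤ R → A ≤ R → -R ^ 2 < t₁ →
                  ∀ s ∈ Set.Icc t₁ t₀,
                    MeasurableSet {y : E3 | y ∈ T ∧ R ≤ ‖X s y‖} ∧
                      (volume {y : E3 | y ∈ T ∧ R ≤ ‖X s y‖}).toReal ≤
                        (C₂ * (c : ℝ) * A ^ 2 * R ^ (-(1 + ρ))) ^ 3 := by
  obtain ⟨C, hC, hK⟩ := hK3
  refine ⟨(4 * C) ^ 2, by positivity, ?_⟩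
  intro ρ hρ u p H c hcls hcl t₁ t₀ T X ht₁ ht₀ hT hX R₀ hR₀ hTR₀ A hA hlen R hRR₀ hAR hRt₁ s hs
  have hR0 : 0 < R := by linarith
  have hR1 : 1 ≤ R := hA.trans hAR
  have hXc : Continuous (fun q : ℝ × E3 => X q.1 q.2) := hX.1
  have hXs : Continuous (X s) := hXc.comp (continuous_const.prodMk continuous_id)
  set E₀ : Set E3 := {y : E3 | y ∈ T ∧ R ≤ ‖X s y‖} with hE₀def
  have hE₀m : MeasurableSet E₀ := hT.inter (measurableSet_le measurable_const hXs.norm.measurable)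
  refine ⟨hE₀m, ?_⟩
  have hE₀T : E₀ ⊆ T := fun y hy => hy.1
  have hfar : ∀ y ∈ E₀, R ≤ ‖X s y‖ := fun y hy => hy.2
  have h3 := hK ρ hρ u p H c hcls hcl t₁ t₀ T X ht₁ ht₀ hT hX R₀ hR₀ hTR₀ R hRR₀ hRt₁ s hs E₀ hE₀T hE₀m hfar
  set v : ℝ := (volume E₀).toReal with hvdef
  have hv0 : 0 ≤ v := ENNReal.toReal_nonneg
  have hc0 : 0 ≤ (c : ℝ) := c.coe_nonneg
  -- time factors: `t₀ - s ≤ A²`, `√(t₀ - s) ≤ A`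
  have hts0 : 0 ≤ t₀ - s := by linarith [hs.2]
  have hts : t₀ - s ≤ A ^ 2 := by linarith [hs.1]
  have hA0 : 0 < A := by linarith
  have hsqrt : Real.sqrt (t₀ - s) ≤ A := by
    calc Real.sqrt (t₀ - s) ≤ Real.sqrt (A ^ 2) := Real.sqrt_le_sqrt hts
      _ = A := Real.sqrt_sq hA0.le
  have hp1 : 0 < R ^ ((1 - ρ) / 2) := Real.rpow_pos_of_pos hR0 _
  have hp2 : 0 < R ^ (-(1 / 2 + ρ)) := Real.rpow_pos_of_pos hR0 _
  have hp3 : 0 < R ^ (-(1 + ρ) / 2) := Real.rpow_pos_of_pos hR0 _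
  have hv16 : 0 ≤ v ^ (1 / 6 : ℝ) := Real.rpow_nonneg hv0 _
  have hsc : 0 ≤ Real.sqrt (c : ℝ) := Real.sqrt_nonneg _
  -- step 1/2: `v^{1/6} R ≤ 2 C √c (A R^{(1-ρ)/2} + A² R^{-(1/2+ρ)})`
  have h4 : v ^ (1 / 6 : ℝ) * R ≤
      2 * (C * Real.sqrt (c : ℝ)) * (A * R ^ ((1 - ρ) / 2) + A ^ 2 * R ^ (-(1 / 2 + ρ))) := by
    have hmono : Real.sqrt (t₀ - s) * R ^ ((1 - ρ) / 2) + (t₀ - s) * R ^ (-(1 / 2 + ρ)) ≤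
        A * R ^ ((1 - ρ) / 2) + A ^ 2 * R ^ (-(1 / 2 + ρ)) :=
      add_le_add (mul_le_mul_of_nonneg_right hsqrt hp1.le) (mul_le_mul_of_nonneg_right hts hp2.le)
    have h5 : v ^ (1 / 6 : ℝ) * (R - R₀) ≤ C * Real.sqrt (c : ℝ) * (A * R ^ ((1 - ρ) / 2) + A ^ 2 * R ^ (-(1 / 2 + ρ))) :=
      h3.trans (mul_le_mul_of_nonneg_left hmono (mul_nonneg hC.le hsc))
    have h6 : v ^ (1 / 6 : ℝ) * R ≤ 2 * (v ^ (1 / 6 : ℝ) * (R - R₀)) := by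
      have : R ≤ 2 * (R - R₀) := by linarith
      nlinarith [hv16, this]
    linarith [h5, h6]
  -- step 3: `A² R^{-(1/2+ρ)} ≤ A R^{(1-ρ)/2}`
  have h7 : A ^ 2 * R ^ (-(1 / 2 + ρ)) ≤ A * R ^ ((1 - ρ) / 2) := by
    have h8 : A * R ^ (-(1 / 2 + ρ)) ≤ R ^ ((1 - ρ) / 2) := by
      calc A * R ^ (-(1 / 2 + ρ)) ≤ R * R ^ (-(1 / 2 + ρ)) := mul_le_mul_of_nonneg_right hAR hp2.le
        _ = R ^ (1 / 2 - ρ) := by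
            rw [show (1 / 2 - ρ : ℝ) = 1 + (-(1 / 2 + ρ)) by ring, Real.rpow_add hR0, Real.rpow_one]
        _ ≤ R ^ ((1 - ρ) / 2) := Real.rpow_le_rpow_of_exponent_le hR1 (by linarith)
    calc A ^ 2 * R ^ (-(1 / 2 + ρ)) = A * (A * R ^ (-(1 / 2 + ρ))) := by ring
      _ ≤ A * R ^ ((1 - ρ) / 2) := mul_le_mul_of_nonneg_left h8 hA0.le
  -- step 4: `v^{1/6} ≤ 4 C √c A R^{-(1+ρ)/2}`
  have h9 : v ^ (1 / 6 : ℝ) * R ≤ (4 * C * Real.sqrt (c : ℝ) * A * R ^ (-(1 + ρ) / 2)) * R := by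
    have e : R ^ ((1 - ρ) / 2) = R ^ (-(1 + ρ) / 2) * R := by
      rw [show ((1 - ρ) / 2 : ℝ) = -(1 + ρ) / 2 + 1 by ring, Real.rpow_add hR0, Real.rpow_one]
    calc v ^ (1 / 6 : ℝ) * R ≤ 2 * (C * Real.sqrt (c : ℝ)) * (A * R ^ ((1 - ρ) / 2) + A * R ^ ((1 - ρ) / 2)) :=
          h4.trans (by gcongr)
      _ = (4 * C * Real.sqrt (c : ℝ) * A * R ^ (-(1 + ρ) / 2)) * R := by rw [e]; ring
  have h10 : v ^ (1 / 6 : ℝ) ≤ 4 * C * Real.sqrt (c : ℝ) * A * R ^ (-(1 + ρ) / 2) :=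
    le_of_mul_le_mul_right h9 hR0
  -- step 5: sixth power
  have hY0 : 0 ≤ 4 * C * Real.sqrt (c : ℝ) * A * R ^ (-(1 + ρ) / 2) := by positivity
  have h11 := pow_le_pow_left₀ hv16 h10 6
  have ev : (v ^ (1 / 6 : ℝ)) ^ (6 : ℕ) = v := by
    rw [← Real.rpow_natCast, ← Real.rpow_mul hv0]; norm_num
  have esc : Real.sqrt (c : ℝ) ^ (6 : ℕ) = (c : ℝ) ^ 3 := by
    rw [show (6 : ℕ) = 2 * 3 by norm_num, pow_mul, Real.sq_sqrt hc0]
  have eR : (R ^ (-(1 + ρ) / 2)) ^ (6 : ℕ) = (R ^ (-(1 + ρ))) ^ 3 := by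
    rw [← Real.rpow_natCast, ← Real.rpow_mul hR0.le, ← Real.rpow_natCast (R ^ (-(1 + ρ))), ← Real.rpow_mul hR0.le]
    congr 1; push_cast; ring
  calc v = (v ^ (1 / 6 : ℝ)) ^ (6 : ℕ) := ev.symm
    _ ≤ (4 * C * Real.sqrt (c : ℝ) * A * R ^ (-(1 + ρ) / 2)) ^ (6 : ℕ) := h11
    _ = (4 * C) ^ 6 * Real.sqrt (c : ℝ) ^ (6 : ℕ) * A ^ 6 * (R ^ (-(1 + ρ) / 2)) ^ (6 : ℕ) := by ring
    _ = (4 * C) ^ 6 * (c : ℝ) ^ 3 * A ^ 6 * (R ^ (-(1 + ρ))) ^ 3 := by rw [esc, eR]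
    _ = ((4 * C) ^ 2 * (c : ℝ) * A ^ 2 * R ^ (-(1 + ρ))) ^ 3 := by ring

/-! ### K4 helper 6: the WINDOW BUDGET (the `E`-gauge, sliced: `∫_{−a²}^{0} (∫_{B_a} ‖∇u(s)‖_F²) ds ≤ c a^{1−ρ}`, with measurability) -/

theorem continuous_frobeniusNormSq_clm : Continuous fun L : E3 →L[ℝ] E3 => frobeniusNormSq L := by
  unfold frobeniusNormSq
  refine continuous_finsetSum _ fun i _ => ?_
  exact ((ContinuousLinearMap.apply ℝ E3 (stdOrthonormalBasis ℝ E3 i)).continuous.norm).pow 2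

/-- **Window budget**: for a member of the class (classical) and a scale `a > 0`, the slice Dirichlet integrals `F_a(s) = ∫_{B_a} ‖∇u(s)‖_F²` are
a.e.-measurable on `(−a², 0)` and `∫_{(−a²,0)} F_a(s) ds ≤ c a^{1−ρ}` (stated in `ℝ≥0∞`). -/
theorem windowBudget {ρ : ℝ} {u : ℝ → E3 → E3} {p : ℝ → E3 → ℝ} {H : ℝ → E3 → E3 →L[ℝ] E3} {c : ℝ≥0}
    (hcls : InClass ρ u p H c) (hcl : IsClassicalEulerSolutionOn (Set.Iio 0) 0 u p) {a : ℝ} (ha : 0 < a) :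
    AEMeasurable (fun s : ℝ => ENNReal.ofReal (∫ x in Metric.ball (0 : E3) a, frobeniusNormSq (fderiv ℝ (u s) x)))
        (volume.restrict (Set.Ioo (-(a ^ 2)) 0)) ∧
      ∫⁻ s in Set.Ioo (-(a ^ 2)) 0, ENNReal.ofReal (∫ x in Metric.ball (0 : E3) a, frobeniusNormSq (fderiv ℝ (u s) x)) ≤
        ENNReal.ofReal ((c : ℝ) * a ^ (1 - ρ)) := by
  obtain ⟨_, hH, hgauge⟩ := hcls
  have hE : ∀ a : ℝ, 0 < a → ENNReal.ofReal (a ^ ρ) * cknE a (0 : ℝ × E3) H ≤ (c : ℝ≥0∞) :=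
    fun a ha => le_trans (le_trans le_add_self le_self_add) (hgauge a ha)
  set I : Set ℝ := Set.Ioo (-(a ^ 2)) 0 with hIdef
  set B : Set E3 := Metric.ball (0 : E3) a with hBdef
  have hI0 : I ⊆ Set.Iio 0 := fun σ hσ => hσ.2
  have hD_cont : ContinuousOn (Function.uncurry fun t x => fderiv ℝ (u t) x) (Set.Iio (0 : ℝ) ×ˢ (Set.univ : Set E3)) :=
    (hcl.smooth_velocity.fderiv_slice isOpen_Iio.uniqueDiffOn).continuousOn
  have hG_cont : ContinuousOn (Function.uncurry fun (t : ℝ) (x : E3) => ENNReal.ofReal (frobeniusNormSq (fderiv ℝ (u t) x)))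
      (Set.Iio (0 : ℝ) ×ˢ (Set.univ : Set E3)) :=
    ENNReal.continuous_ofReal.comp_continuousOn (continuous_frobeniusNormSq_clm.comp_continuousOn hD_cont)
  have hGi : AEMeasurable (Function.uncurry fun (σ : ℝ) (x : E3) => ENNReal.ofReal (frobeniusNormSq (fderiv ℝ (u σ) x)))
      ((volume.restrict I).prod (volume.restrict B)) := by
    rw [Measure.prod_restrict, ← Measure.volume_eq_prod]
    exact (hG_cont.mono (Set.prod_mono hI0 (Set.subset_univ _))).aemeasurable (measurableSet_Ioo.prod measurableSet_ball)
  -- per-slice identity `ofReal (∫_B frob) = ∫⁻_B ofReal frob`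
  have hslice : ∀ σ ∈ I, ENNReal.ofReal (∫ x in B, frobeniusNormSq (fderiv ℝ (u σ) x)) =
      ∫⁻ x in B, ENNReal.ofReal (frobeniusNormSq (fderiv ℝ (u σ) x)) := by
    intro σ hσ
    have hv : ContDiff ℝ 1 (u σ) := (hcl.contDiff_velocity (hI0 hσ)).of_le (by norm_cast)
    have hFc : Continuous fun x => frobeniusNormSq (fderiv ℝ (u σ) x) := continuous_frobeniusNormSq_fderiv hv one_ne_zero
    have hint : IntegrableOn (fun x => frobeniusNormSq (fderiv ℝ (u σ) x)) B volume :=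
      (hFc.continuousOn.integrableOn_compact (isCompact_closedBall (0 : E3) a)).mono_set Metric.ball_subset_closedBall
    exact ofReal_integral_eq_lintegral_ofReal hint (ae_of_all _ fun x => frobeniusNormSq_nonneg _)
  have hae : (fun σ : ℝ => ∫⁻ x in B, ENNReal.ofReal (frobeniusNormSq (fderiv ℝ (u σ) x))) =ᵐ[volume.restrict I]
      fun σ : ℝ => ENNReal.ofReal (∫ x in B, frobeniusNormSq (fderiv ℝ (u σ) x)) :=
    (ae_restrict_iff' measurableSet_Ioo).2 (ae_of_all _ fun σ hσ => (hslice σ hσ).symm)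
  refine ⟨hGi.lintegral_prod_right'.congr hae, ?_⟩
  calc ∫⁻ s in I, ENNReal.ofReal (∫ x in B, frobeniusNormSq (fderiv ℝ (u s) x))
      = ∫⁻ s in I, ∫⁻ x in B, ENNReal.ofReal (frobeniusNormSq (fderiv ℝ (u s) x)) := setLIntegral_congr_fun measurableSet_Ioo hslice
    _ = ∫⁻ z in I ×ˢ B, ENNReal.ofReal (frobeniusNormSq (fderiv ℝ (u z.1) z.2)) := by
        rw [lintegral_lintegral hGi, Measure.prod_restrict, ← Measure.volume_eq_prod]
    _ ≤ ENNReal.ofReal ((c : ℝ) * a ^ (1 - ρ)) := by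
        rw [hIdef, hBdef, show (-(a ^ 2) : ℝ) = -a ^ 2 by ring]
        exact SwirlfreeLedger.setLIntegral_window_frobenius_fderiv_le hH hcl hE ha

/-! ### K4 helper 7: the RACE SERIES (pure real analysis: the `j`-sum of `budget_j / floor_j` is `K₁A^{1−ρ} + K₂A^{2−2ρ} + K₃A^{2−5ρ}`) -/

/-- pigeonhole share of shell `j`: `η_j = h / (4 (j+1)²)`. -/
def eta (h : ℝ) (j : ℕ) : ℝ := h / (4 * ((j : ℝ) + 1) ^ 2)

/-- the member shell floor's output (K4a) with share `η_j`, volume majorant `V` and ball radius `Rad`. -/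
def eFloor (ρ C₁ c h V Rad : ℝ) (j : ℕ) : ℝ :=
  min (eta h j / (C₁ * V ^ (1 / 3 : ℝ))) (eta h j ^ 2 * Rad ^ (1 + 2 * ρ) / (C₁ * c * V ^ (2 / 3 : ℝ)))

/-- radius of the ball hosting shell `j` at scale `A`: `2^{j+1} A` (shell `0` = the core ball `B(0,2A)`, shell `j ≥ 1` = `{2^j A ≤ ‖x‖ < 2^{j+1}A}`). -/
def shellRad (A : ℝ) (j : ℕ) : ℝ := 2 ^ (j + 1) * A

/-- volume majorant of the labels feeding shell `j`: all labels (`v₀`) for the core, the far-label bound (K4b, cubed form, radius `2^j A`) beyond. -/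
def shellVol (ρ C₂ c v₀ A : ℝ) : ℕ → ℝ
  | 0 => v₀
  | (j + 1) => (C₂ * c * A ^ 2 * (2 ^ (j + 1) * A) ^ (-(1 + ρ))) ^ 3

theorem eta_pos {h : ℝ} (hh : 0 < h) (j : ℕ) : 0 < eta h j := by
  unfold eta; positivity

theorem eFloor_pos {ρ C₁ c h V Rad : ℝ} (hC₁ : 0 < C₁) (hc : 0 < c) (hh : 0 < h) (hV : 0 < V) (hRad : 0 < Rad) (j : ℕ) :
    0 < eFloor ρ C₁ c h V Rad j := by
  unfold eFloor
  have := eta_pos hh j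
  have h1 : 0 < V ^ (1 / 3 : ℝ) := Real.rpow_pos_of_pos hV _
  have h2 : 0 < V ^ (2 / 3 : ℝ) := Real.rpow_pos_of_pos hV _
  have h3 : 0 < Rad ^ (1 + 2 * ρ) := Real.rpow_pos_of_pos hRad _
  exact lt_min (by positivity) (by positivity)

theorem shellRad_pos {A : ℝ} (hA : 0 < A) (j : ℕ) : 0 < shellRad A j := by
  unfold shellRad; positivity

theorem shellVol_pos {ρ C₂ c v₀ A : ℝ} (hC₂ : 0 < C₂) (hc : 0 < c) (hv₀ : 0 < v₀) (hA : 0 < A) :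
    ∀ j : ℕ, 0 < shellVol ρ C₂ c v₀ A j
  | 0 => hv₀
  | (j + 1) => by
      simp only [shellVol]
      have : 0 < (2 ^ (j + 1) * A) ^ (-(1 + ρ)) := Real.rpow_pos_of_pos (by positivity) _
      positivity

theorem div_min_le_add {x a b : ℝ} (hx : 0 ≤ x) (ha : 0 < a) (hb : 0 < b) : x / min a b ≤ x / a + x / b := by
  rcases min_choice a b with hm | hm <;> rw [hm]
  · linarith [div_nonneg hx hb.le]
  · linarith [div_nonneg hx ha.le]

theorem summable_shift_sq_geometric {r : ℝ} (hr0 : 0 < r) (hr1 : r < 1) (k : ℕ) :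
    Summable fun i : ℕ => ((i : ℝ) + 2) ^ k * r ^ (i + 1) := by
  have hf := summable_pow_mul_geometric_of_norm_lt_one k (show ‖r‖ < 1 by rwa [Real.norm_of_nonneg hr0.le])
  have hf2 := ((summable_nat_add_iff 2).2 hf).mul_left r⁻¹
  refine hf2.congr fun i => ?_
  have hr : r ≠ 0 := hr0.ne'
  push_cast
  rw [show ((i : ℝ) + 2) ^ k * r ^ (i + 2) = r * (((i : ℝ) + 2) ^ k * r ^ (i + 1)) by ring, ← mul_assoc,
    inv_mul_cancel₀ hr, one_mul]

/-- race term `j = 0` (the core): `≤ K₁ A^{1−ρ}`. -/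
theorem raceTerm_zero {ρ C₁ C₂ c h v₀ : ℝ} (hρ : 0 < ρ) (hC₁ : 0 < C₁) (hc : 0 < c) (hh : 0 < h) (hv₀ : 0 < v₀)
    {A : ℝ} (hA : 1 ≤ A) :
    c * shellRad A 0 ^ (1 - ρ) / eFloor ρ C₁ c h (shellVol ρ C₂ c v₀ A 0) (shellRad A 0) 0 ≤
      (2 * c * C₁ * (v₀ ^ (1 / 3 : ℝ) / eta h 0 + c * v₀ ^ (2 / 3 : ℝ) / eta h 0 ^ 2)) * A ^ (1 - ρ) := by
  simp only [shellRad, shellVol, eFloor, zero_add, pow_one]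
  set η₀ : ℝ := eta h 0 with hη₀def
  have hη₀ : 0 < η₀ := eta_pos hh 0
  have hA0 : 0 < A := by linarith
  have hApow : 0 < A ^ (1 - ρ) := Real.rpow_pos_of_pos hA0 _
  have hv13 : 0 < v₀ ^ (1 / 3 : ℝ) := Real.rpow_pos_of_pos hv₀ _
  have hv23 : 0 < v₀ ^ (2 / 3 : ℝ) := Real.rpow_pos_of_pos hv₀ _
  have hRad : 0 < 2 * A := by positivity
  have hRad1 : 0 < (2 * A) ^ (1 - ρ) := Real.rpow_pos_of_pos hRad _
  have hRad2 : 0 < (2 * A) ^ (1 + 2 * ρ) := Real.rpow_pos_of_pos hRad _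
  have ha : 0 < η₀ / (C₁ * v₀ ^ (1 / 3 : ℝ)) := by positivity
  have hb : 0 < η₀ ^ 2 * (2 * A) ^ (1 + 2 * ρ) / (C₁ * c * v₀ ^ (2 / 3 : ℝ)) := by positivity
  have hx : 0 ≤ c * (2 * A) ^ (1 - ρ) := by positivity
  refine (div_min_le_add hx ha hb).trans ?_
  have e1 : (2 * A) ^ (1 - ρ) ≤ 2 * A ^ (1 - ρ) := by
    rw [Real.mul_rpow zero_le_two hA0.le]
    refine mul_le_mul_of_nonneg_right ?_ hApow.le
    calc (2 : ℝ) ^ (1 - ρ) ≤ (2 : ℝ) ^ (1 : ℝ) := Real.rpow_le_rpow_of_exponent_le one_le_two (by linarith)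
      _ = 2 := Real.rpow_one _
  have e2 : 1 ≤ (2 * A) ^ (1 + 2 * ρ) := Real.one_le_rpow (by linarith) (by linarith)
  have t1 : c * (2 * A) ^ (1 - ρ) / (η₀ / (C₁ * v₀ ^ (1 / 3 : ℝ))) ≤ 2 * c * C₁ * (v₀ ^ (1 / 3 : ℝ) / η₀) * A ^ (1 - ρ) := by
    rw [div_div_eq_mul_div, div_le_iff₀ hη₀]
    calc c * (2 * A) ^ (1 - ρ) * (C₁ * v₀ ^ (1 / 3 : ℝ)) ≤ c * (2 * A ^ (1 - ρ)) * (C₁ * v₀ ^ (1 / 3 : ℝ)) :=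
          mul_le_mul_of_nonneg_right (mul_le_mul_of_nonneg_left e1 hc.le) (by positivity)
      _ = 2 * c * C₁ * (v₀ ^ (1 / 3 : ℝ) / η₀) * A ^ (1 - ρ) * η₀ := by
          rw [mul_div_assoc']
          rw [div_mul_eq_mul_div, div_mul_eq_mul_div, eq_div_iff hη₀.ne']
          ring
  have t2 : c * (2 * A) ^ (1 - ρ) / (η₀ ^ 2 * (2 * A) ^ (1 + 2 * ρ) / (C₁ * c * v₀ ^ (2 / 3 : ℝ))) ≤
      2 * c * C₁ * (c * v₀ ^ (2 / 3 : ℝ) / η₀ ^ 2) * A ^ (1 - ρ) := by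
    rw [div_div_eq_mul_div, div_le_iff₀ (by positivity)]
    calc c * (2 * A) ^ (1 - ρ) * (C₁ * c * v₀ ^ (2 / 3 : ℝ)) ≤ c * (2 * A ^ (1 - ρ)) * (C₁ * c * v₀ ^ (2 / 3 : ℝ)) :=
          mul_le_mul_of_nonneg_right (mul_le_mul_of_nonneg_left e1 hc.le) (by positivity)
      _ = 2 * c * C₁ * (c * v₀ ^ (2 / 3 : ℝ) / η₀ ^ 2) * A ^ (1 - ρ) * (η₀ ^ 2 * 1) := by
          rw [mul_one, mul_div_assoc', div_mul_eq_mul_div, div_mul_eq_mul_div, eq_div_iff (pow_ne_zero 2 hη₀.ne')]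
          ring
      _ ≤ 2 * c * C₁ * (c * v₀ ^ (2 / 3 : ℝ) / η₀ ^ 2) * A ^ (1 - ρ) * (η₀ ^ 2 * (2 * A) ^ (1 + 2 * ρ)) :=
          mul_le_mul_of_nonneg_left (mul_le_mul_of_nonneg_left e2 (sq_nonneg _)) (by positivity)
  calc _ ≤ _ := add_le_add t1 t2
    _ = _ := by ring

/-- race term `j = i+1` (the shells): `≤ L₂ A^{2−2ρ} (i+2)² r₁^{i+1} + L₃ A^{2−5ρ} (i+2)⁴ 2^{−(i+1)}` with `r₁ = 2^{−2ρ}`. -/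
theorem raceTerm_succ {ρ C₁ C₂ c h v₀ : ℝ} (hρ : 0 < ρ) (hC₁ : 0 < C₁) (hC₂ : 0 < C₂) (hc : 0 < c) (hh : 0 < h)
    {A : ℝ} (hA : 1 ≤ A) (i : ℕ) :
    c * shellRad A (i + 1) ^ (1 - ρ) / eFloor ρ C₁ c h (shellVol ρ C₂ c v₀ A (i + 1)) (shellRad A (i + 1)) (i + 1) ≤
      (8 * C₁ * C₂ * c ^ 2 / h) * A ^ (2 - 2 * ρ) * (((i : ℝ) + 2) ^ 2 * ((2 : ℝ) ^ (-(2 * ρ))) ^ (i + 1)) +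
        (32 * C₁ * C₂ ^ 2 * c ^ 4 / h ^ 2) * A ^ (2 - 5 * ρ) * (((i : ℝ) + 2) ^ 4 * (1 / 2 : ℝ) ^ (i + 1)) := by
  simp only [shellRad, shellVol, eFloor]
  have hA0 : 0 < A := by linarith
  have hApow : ∀ e : ℝ, 0 < A ^ e := fun e => Real.rpow_pos_of_pos hA0 e
  set r₁ : ℝ := (2 : ℝ) ^ (-(2 * ρ)) with hr₁def
  set t : ℝ := (2 : ℝ) ^ (i + 1) with htdef
  have ht1 : 1 ≤ t := one_le_pow₀ one_le_two
  have ht0 : 0 < t := by positivity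
  have hRad_eq : (2 : ℝ) ^ (i + 1 + 1) * A = 2 * t * A := by rw [htdef, pow_succ]; ring
  rw [hRad_eq]
  set η : ℝ := eta h (i + 1) with hηdef
  have hη : 0 < η := eta_pos hh _
  have hη_eq : η = h / (4 * ((i : ℝ) + 2) ^ 2) := by
    rw [hηdef, eta]; push_cast; ring_nf
  set X : ℝ := C₂ * c * A ^ 2 * (t * A) ^ (-(1 + ρ)) with hXdef
  have htA : 0 < t * A := by positivity
  have htApow : 0 < (t * A) ^ (-(1 + ρ)) := Real.rpow_pos_of_pos htA _
  have hX0 : 0 < X := by positivity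
  have hV13 : (X ^ 3) ^ (1 / 3 : ℝ) = X := by
    rw [one_div, show (3 : ℝ) = ((3 : ℕ) : ℝ) by norm_num]
    exact Real.pow_rpow_inv_natCast hX0.le three_ne_zero
  have hV23 : (X ^ 3) ^ (2 / 3 : ℝ) = X ^ 2 := by
    rw [← Real.rpow_natCast X 3, ← Real.rpow_mul hX0.le]; norm_num
  rw [hV13, hV23]
  have hRad : 0 < 2 * t * A := by positivity
  have hRad1 : 0 < (2 * t * A) ^ (1 - ρ) := Real.rpow_pos_of_pos hRad _
  have hRad2 : 0 < (2 * t * A) ^ (1 + 2 * ρ) := Real.rpow_pos_of_pos hRad _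
  have ha : 0 < η / (C₁ * X) := by positivity
  have hb : 0 < η ^ 2 * (2 * t * A) ^ (1 + 2 * ρ) / (C₁ * c * X ^ 2) := by positivity
  have hx : 0 ≤ c * (2 * t * A) ^ (1 - ρ) := by positivity
  refine (div_min_le_add hx ha hb).trans ?_
  -- exponent bookkeeping
  have ht1ρ : 0 ≤ t ^ (1 - ρ) := Real.rpow_nonneg ht0.le _
  have eRad : (2 * t * A) ^ (1 - ρ) ≤ 2 * t ^ (1 - ρ) * A ^ (1 - ρ) := by
    rw [Real.mul_rpow (by positivity) hA0.le, Real.mul_rpow zero_le_two ht0.le]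
    refine mul_le_mul_of_nonneg_right (mul_le_mul_of_nonneg_right ?_ ht1ρ) (hApow _).le
    calc (2 : ℝ) ^ (1 - ρ) ≤ (2 : ℝ) ^ (1 : ℝ) := Real.rpow_le_rpow_of_exponent_le one_le_two (by linarith)
      _ = 2 := Real.rpow_one _
  have eX : X = C₂ * c * t ^ (-(1 + ρ)) * A ^ (1 - ρ) := by
    have e2 : A ^ 2 * A ^ (-(1 + ρ)) = A ^ (1 - ρ) := by
      rw [← Real.rpow_natCast A 2, ← Real.rpow_add hA0, show ((2 : ℕ) : ℝ) + (-(1 + ρ)) = 1 - ρ by push_cast; ring]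
    rw [hXdef, Real.mul_rpow ht0.le hA0.le]
    calc C₂ * c * A ^ 2 * (t ^ (-(1 + ρ)) * A ^ (-(1 + ρ))) = C₂ * c * t ^ (-(1 + ρ)) * (A ^ 2 * A ^ (-(1 + ρ))) := by ring
      _ = _ := by rw [e2]
  have ett : t ^ (1 - ρ) * t ^ (-(1 + ρ)) = r₁ ^ (i + 1) := by
    rw [← Real.rpow_add ht0, show (1 - ρ) + (-(1 + ρ)) = -(2 * ρ) by ring, htdef, hr₁def,
      ← Real.rpow_natCast (2 : ℝ) (i + 1), ← Real.rpow_mul zero_le_two, mul_comm, Real.rpow_mul zero_le_two,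
      Real.rpow_natCast]
  have ett2 : t ^ (1 - ρ) * (t ^ (-(1 + ρ))) ^ 2 ≤ (1 / 2 : ℝ) ^ (i + 1) := by
    rw [← Real.rpow_natCast (t ^ (-(1 + ρ))) 2, ← Real.rpow_mul ht0.le, ← Real.rpow_add ht0]
    calc t ^ ((1 - ρ) + (-(1 + ρ)) * ((2 : ℕ) : ℝ)) ≤ t ^ (-1 : ℝ) :=
          Real.rpow_le_rpow_of_exponent_le ht1 (by push_cast; linarith)
      _ = (1 / 2 : ℝ) ^ (i + 1) := by rw [Real.rpow_neg_one, htdef, one_div, inv_pow]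
  have eAA : A ^ (1 - ρ) * A ^ (1 - ρ) = A ^ (2 - 2 * ρ) := by
    rw [show (2 - 2 * ρ : ℝ) = (1 - ρ) + (1 - ρ) by ring, Real.rpow_add hA0]
  have eRadbig : A ^ (1 + 2 * ρ) ≤ (2 * t * A) ^ (1 + 2 * ρ) := by
    rw [Real.mul_rpow (by positivity) hA0.le]
    have : 1 ≤ (2 * t) ^ (1 + 2 * ρ) := Real.one_le_rpow (by linarith) (by linarith)
    exact le_mul_of_one_le_left (hApow _).le this
  have eA3 : A ^ (1 - ρ) * A ^ (2 - 2 * ρ) = A ^ (2 - 5 * ρ) * A ^ (1 + 2 * ρ) := by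
    rw [← Real.rpow_add hA0, ← Real.rpow_add hA0, show (1 - ρ) + (2 - 2 * ρ) = (2 - 5 * ρ) + (1 + 2 * ρ) by ring]
  have hh0 : h ≠ 0 := hh.ne'
  have hi2 : ((i : ℝ) + 2) ≠ 0 := by positivity
  -- first piece
  have t1 : c * (2 * t * A) ^ (1 - ρ) / (η / (C₁ * X)) ≤
      (8 * C₁ * C₂ * c ^ 2 / h) * A ^ (2 - 2 * ρ) * (((i : ℝ) + 2) ^ 2 * r₁ ^ (i + 1)) := by
    rw [div_div_eq_mul_div, div_le_iff₀ hη]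
    calc c * (2 * t * A) ^ (1 - ρ) * (C₁ * X) ≤ c * (2 * t ^ (1 - ρ) * A ^ (1 - ρ)) * (C₁ * X) :=
          mul_le_mul_of_nonneg_right (mul_le_mul_of_nonneg_left eRad hc.le) (by positivity)
      _ = 2 * C₁ * C₂ * c ^ 2 * (t ^ (1 - ρ) * t ^ (-(1 + ρ))) * (A ^ (1 - ρ) * A ^ (1 - ρ)) := by rw [eX]; ring
      _ = 2 * C₁ * C₂ * c ^ 2 * r₁ ^ (i + 1) * A ^ (2 - 2 * ρ) := by rw [ett, eAA]
      _ = (8 * C₁ * C₂ * c ^ 2 / h) * A ^ (2 - 2 * ρ) * (((i : ℝ) + 2) ^ 2 * r₁ ^ (i + 1)) * η := by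
          rw [hη_eq]; field_simp; ring
  -- second piece
  have t2 : c * (2 * t * A) ^ (1 - ρ) / (η ^ 2 * (2 * t * A) ^ (1 + 2 * ρ) / (C₁ * c * X ^ 2)) ≤
      (32 * C₁ * C₂ ^ 2 * c ^ 4 / h ^ 2) * A ^ (2 - 5 * ρ) * (((i : ℝ) + 2) ^ 4 * (1 / 2 : ℝ) ^ (i + 1)) := by
    rw [div_div_eq_mul_div, div_le_iff₀ (by positivity)]
    calc c * (2 * t * A) ^ (1 - ρ) * (C₁ * c * X ^ 2) ≤ c * (2 * t ^ (1 - ρ) * A ^ (1 - ρ)) * (C₁ * c * X ^ 2) :=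
          mul_le_mul_of_nonneg_right (mul_le_mul_of_nonneg_left eRad hc.le) (by positivity)
      _ = 2 * C₁ * C₂ ^ 2 * c ^ 4 * (t ^ (1 - ρ) * (t ^ (-(1 + ρ))) ^ 2) * (A ^ (1 - ρ) * (A ^ (1 - ρ)) ^ 2) := by
          rw [eX]; ring
      _ ≤ 2 * C₁ * C₂ ^ 2 * c ^ 4 * (1 / 2 : ℝ) ^ (i + 1) * (A ^ (1 - ρ) * (A ^ (1 - ρ)) ^ 2) := by
          have h0 : 0 ≤ A ^ (1 - ρ) * (A ^ (1 - ρ)) ^ 2 := by positivity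
          have h1 : 0 ≤ 2 * C₁ * C₂ ^ 2 * c ^ 4 := by positivity
          exact mul_le_mul_of_nonneg_right (mul_le_mul_of_nonneg_left ett2 h1) h0
      _ = 2 * C₁ * C₂ ^ 2 * c ^ 4 * (1 / 2 : ℝ) ^ (i + 1) * (A ^ (2 - 5 * ρ) * A ^ (1 + 2 * ρ)) := by
          rw [sq (A ^ (1 - ρ)), eAA, eA3]
      _ ≤ 2 * C₁ * C₂ ^ 2 * c ^ 4 * (1 / 2 : ℝ) ^ (i + 1) * (A ^ (2 - 5 * ρ) * (2 * t * A) ^ (1 + 2 * ρ)) := by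
          have h1 : 0 ≤ 2 * C₁ * C₂ ^ 2 * c ^ 4 * (1 / 2 : ℝ) ^ (i + 1) := by positivity
          exact mul_le_mul_of_nonneg_left (mul_le_mul_of_nonneg_left eRadbig (hApow _).le) h1
      _ = (32 * C₁ * C₂ ^ 2 * c ^ 4 / h ^ 2) * A ^ (2 - 5 * ρ) * (((i : ℝ) + 2) ^ 4 * (1 / 2 : ℝ) ^ (i + 1)) *
            (η ^ 2 * (2 * t * A) ^ (1 + 2 * ρ)) := by
          rw [hη_eq]; field_simp; ring
  exact add_le_add t1 t2

/-- **Race series**: for `ρ > 0` and positive constants, there are `K₁ K₂ K₃ ≥ 0` such that for every scale `A ≥ 1` and every number of shells `J`,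
`∑_{j<J} c (2^{j+1}A)^{1−ρ} / eFloor_j ≤ K₁ A^{1−ρ} + K₂ A^{2−2ρ} + K₃ A^{2−5ρ}`. -/
theorem raceSeries {ρ C₁ C₂ c h v₀ : ℝ} (hρ : 0 < ρ) (hC₁ : 0 < C₁) (hC₂ : 0 < C₂) (hc : 0 < c) (hh : 0 < h)
    (hv₀ : 0 < v₀) :
    ∃ K₁ K₂ K₃ : ℝ, 0 ≤ K₁ ∧ 0 ≤ K₂ ∧ 0 ≤ K₃ ∧ ∀ A : ℝ, 1 ≤ A → ∀ J : ℕ,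
      ∑ j ∈ Finset.range J, c * shellRad A j ^ (1 - ρ) / eFloor ρ C₁ c h (shellVol ρ C₂ c v₀ A j) (shellRad A j) j ≤
        K₁ * A ^ (1 - ρ) + K₂ * A ^ (2 - 2 * ρ) + K₃ * A ^ (2 - 5 * ρ) := by
  set r₁ : ℝ := (2 : ℝ) ^ (-(2 * ρ)) with hr₁def
  have hr₁pos : 0 < r₁ := Real.rpow_pos_of_pos two_pos _
  have hr₁lt : r₁ < 1 := Real.rpow_lt_one_of_one_lt_of_neg one_lt_two (by linarith)
  set p₁ : ℕ → ℝ := fun i => ((i : ℝ) + 2) ^ 2 * r₁ ^ (i + 1) with hp₁def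
  set p₂ : ℕ → ℝ := fun i => ((i : ℝ) + 2) ^ 4 * (1 / 2 : ℝ) ^ (i + 1) with hp₂def
  have hp₁s : Summable p₁ := summable_shift_sq_geometric hr₁pos hr₁lt 2
  have hp₂s : Summable p₂ := summable_shift_sq_geometric (by norm_num) (by norm_num) 4
  have hp₁0 : ∀ i, 0 ≤ p₁ i := fun i => by positivity
  have hp₂0 : ∀ i, 0 ≤ p₂ i := fun i => by positivity
  have hη₀ : 0 < eta h 0 := eta_pos hh 0
  have hv13 : 0 < v₀ ^ (1 / 3 : ℝ) := Real.rpow_pos_of_pos hv₀ _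
  have hv23 : 0 < v₀ ^ (2 / 3 : ℝ) := Real.rpow_pos_of_pos hv₀ _
  set K₁ : ℝ := 2 * c * C₁ * (v₀ ^ (1 / 3 : ℝ) / eta h 0 + c * v₀ ^ (2 / 3 : ℝ) / eta h 0 ^ 2) with hK₁def
  set L₂ : ℝ := 8 * C₁ * C₂ * c ^ 2 / h with hL₂def
  set L₃ : ℝ := 32 * C₁ * C₂ ^ 2 * c ^ 4 / h ^ 2 with hL₃def
  have hK₁ : 0 ≤ K₁ := by positivity
  have hL₂ : 0 ≤ L₂ := by positivity
  have hL₃ : 0 ≤ L₃ := by positivity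
  refine ⟨K₁, L₂ * ∑' i, p₁ i, L₃ * ∑' i, p₂ i, hK₁, mul_nonneg hL₂ (tsum_nonneg hp₁0),
    mul_nonneg hL₃ (tsum_nonneg hp₂0), ?_⟩
  intro A hA J
  have hA0 : 0 < A := by linarith
  have hApow : ∀ e : ℝ, 0 < A ^ e := fun e => Real.rpow_pos_of_pos hA0 e
  have hterm0 := raceTerm_zero (C₂ := C₂) hρ hC₁ hc hh hv₀ hA
  have htermS := raceTerm_succ (v₀ := v₀) hρ hC₁ hC₂ hc hh hA
  have hRHS0 : 0 ≤ K₁ * A ^ (1 - ρ) + (L₂ * ∑' i, p₁ i) * A ^ (2 - 2 * ρ) + (L₃ * ∑' i, p₂ i) * A ^ (2 - 5 * ρ) := by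
    have h1 : 0 ≤ ∑' i, p₁ i := tsum_nonneg hp₁0
    have h2 : 0 ≤ ∑' i, p₂ i := tsum_nonneg hp₂0
    have := hApow (1 - ρ); have := hApow (2 - 2 * ρ); have := hApow (2 - 5 * ρ)
    positivity
  cases J with
  | zero => simpa using hRHS0
  | succ n =>
    rw [Finset.sum_range_succ']
    have hS : ∑ i ∈ Finset.range n,
        c * shellRad A (i + 1) ^ (1 - ρ) / eFloor ρ C₁ c h (shellVol ρ C₂ c v₀ A (i + 1)) (shellRad A (i + 1)) (i + 1) ≤
        (L₂ * ∑' i, p₁ i) * A ^ (2 - 2 * ρ) + (L₃ * ∑' i, p₂ i) * A ^ (2 - 5 * ρ) := by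
      calc _ ≤ ∑ i ∈ Finset.range n, (L₂ * A ^ (2 - 2 * ρ) * p₁ i + L₃ * A ^ (2 - 5 * ρ) * p₂ i) :=
            Finset.sum_le_sum fun i _ => htermS i
        _ = L₂ * A ^ (2 - 2 * ρ) * ∑ i ∈ Finset.range n, p₁ i + L₃ * A ^ (2 - 5 * ρ) * ∑ i ∈ Finset.range n, p₂ i := by
            rw [Finset.sum_add_distrib, Finset.mul_sum, Finset.mul_sum]
        _ ≤ L₂ * A ^ (2 - 2 * ρ) * ∑' i, p₁ i + L₃ * A ^ (2 - 5 * ρ) * ∑' i, p₂ i := by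
            have h1 := hp₁s.sum_le_tsum (Finset.range n) (fun i _ => hp₁0 i)
            have h2 := hp₂s.sum_le_tsum (Finset.range n) (fun i _ => hp₂0 i)
            have h3 : 0 ≤ L₂ * A ^ (2 - 2 * ρ) := mul_nonneg hL₂ (hApow _).le
            have h4 : 0 ≤ L₃ * A ^ (2 - 5 * ρ) := mul_nonneg hL₃ (hApow _).le
            exact add_le_add (mul_le_mul_of_nonneg_left h1 h3) (mul_le_mul_of_nonneg_left h2 h4)
        _ = _ := by ring
    linarith [hS, hterm0]

/-! ### K4 helper 8: the HOSTING SHELL (dyadic shell decomposition of a weighted helicity + pigeonhole) -/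

/-- shell `j` at scale `A`: the core ball `{‖x‖ < 2A}` for `j = 0`, the dyadic shell `{2^j A ≤ ‖x‖ < 2^{j+1} A}` for `j ≥ 1`. -/
def shellSet (A : ℝ) (j : ℕ) : Set E3 := {x : E3 | (j = 0 ∨ 2 ^ j * A ≤ ‖x‖) ∧ ‖x‖ < 2 ^ (j + 1) * A}

theorem measurableSet_shellSet (A : ℝ) (j : ℕ) : MeasurableSet (shellSet A j) := by
  have h1 : MeasurableSet {x : E3 | j = 0 ∨ 2 ^ j * A ≤ ‖x‖} := by
    by_cases hj : j = 0
    · simp [hj]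
    · simp only [hj, false_or]; exact measurableSet_le measurable_const continuous_norm.measurable
  exact h1.inter (measurableSet_lt continuous_norm.measurable measurable_const)

theorem shellSet_subset_ball (A : ℝ) (j : ℕ) : shellSet A j ⊆ Metric.ball (0 : E3) (2 ^ (j + 1) * A) :=
  fun x hx => by rw [Metric.mem_ball, dist_zero_right]; exact hx.2

theorem shellSet_disjoint {A : ℝ} (hA : 0 < A) {j k : ℕ} (hjk : j ≠ k) {x : E3} (hj : x ∈ shellSet A j) (hk : x ∈ shellSet A k) :
    False := by
  wlog h : j < k generalizing j k
  · exact this hjk.symm hk hj (lt_of_le_of_ne (not_lt.1 h) hjk.symm)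
  have hk1 : k ≠ 0 := by omega
  rcases hk.1 with h0 | hle
  · exact hk1 h0
  have hlt := hj.2
  have hpow : (2 : ℝ) ^ (j + 1) * A ≤ 2 ^ k * A :=
    mul_le_mul_of_nonneg_right (pow_le_pow_right₀ one_le_two (by omega)) hA.le
  linarith

theorem exists_shellSet (A : ℝ) : ∀ J : ℕ, 1 ≤ J → ∀ x : E3, ‖x‖ < 2 ^ J * A → ∃ j, j < J ∧ x ∈ shellSet A j := by
  intro J hJ
  induction J, hJ using Nat.le_induction with
  | base => intro x hx; exact ⟨0, zero_lt_one, Or.inl rfl, by simpa using hx⟩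
  | succ n hn ih =>
      intro x hx
      by_cases h : ‖x‖ < 2 ^ n * A
      · obtain ⟨j, hj, hjx⟩ := ih x h
        exact ⟨j, by omega, hjx⟩
      · exact ⟨n, by omega, Or.inr (not_lt.1 h), hx⟩

theorem sum_indicator_shellSet {A : ℝ} (hA : 0 < A) {J : ℕ} (hJ : 1 ≤ J) (χ : E3 → ℝ) {R' : ℝ} (hR' : R' ≤ 2 ^ J * A)
    (hsupp : ∀ x : E3, χ x ≠ 0 → ‖x‖ < R') (x : E3) :
    ∑ j ∈ Finset.range J, (shellSet A j).indicator χ x = χ x := by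
  classical
  by_cases hx : ‖x‖ < 2 ^ J * A
  · obtain ⟨j₀, hj₀, hx₀⟩ := exists_shellSet A J hJ x hx
    rw [Finset.sum_eq_single j₀, Set.indicator_of_mem hx₀]
    · intro j _ hj
      rw [Set.indicator_of_notMem]
      exact fun hxj => shellSet_disjoint hA hj hxj hx₀
    · intro h; exact absurd (Finset.mem_range.2 hj₀) h
  · have hχ : χ x = 0 := by
      by_contra h; exact hx (lt_of_lt_of_le (hsupp x h) hR')
    rw [hχ]
    refine Finset.sum_eq_zero fun j hj => ?_
    rw [Set.indicator_of_notMem]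
    intro hxj
    have := hxj.2
    have hpow : (2 : ℝ) ^ (j + 1) * A ≤ 2 ^ J * A :=
      mul_le_mul_of_nonneg_right (pow_le_pow_right₀ one_le_two (by have := Finset.mem_range.1 hj; omega)) hA.le
    exact hx (lt_of_lt_of_le this hpow)

/-- **Hosting shell**: if `χ·g` is integrable, `χ` vanishes where `‖x‖ ≥ R'`, `R' ≤ 2^J A` (`J ≥ 1`) and `H = ∫ χ g ≠ 0`, then some shell `j < J`
hosts the pigeonhole share: `|H| / (4 (j+1)²) ≤ |∫_{B(0, 2^{j+1}A)} 𝟙_{shell j} χ g|`. -/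
theorem hostingShell {χ g : E3 → ℝ} (hint : Integrable (fun x => χ x * g x)) {A R' : ℝ} (hA : 0 < A)
    (hsupp : ∀ x : E3, χ x ≠ 0 → ‖x‖ < R') {J : ℕ} (hJ : 1 ≤ J) (hR' : R' ≤ 2 ^ J * A)
    (hH : ∫ x, χ x * g x ≠ 0) :
    ∃ j, j < J ∧ |∫ x, χ x * g x| / (4 * ((j : ℝ) + 1) ^ 2) ≤
      |∫ x in Metric.ball (0 : E3) (2 ^ (j + 1) * A), (shellSet A j).indicator χ x * g x| := by
  classical
  set hj : ℕ → ℝ := fun j => ∫ x, (shellSet A j).indicator χ x * g x with hhj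
  have hind : ∀ j, (fun x => (shellSet A j).indicator χ x * g x) = (shellSet A j).indicator (fun x => χ x * g x) := by
    intro j; funext x
    by_cases hx : x ∈ shellSet A j
    · simp [Set.indicator_of_mem hx]
    · simp [Set.indicator_of_notMem hx]
  have hintj : ∀ j, Integrable (fun x => (shellSet A j).indicator χ x * g x) := by
    intro j; rw [hind j]; exact hint.indicator (measurableSet_shellSet A j)
  have hsum : ∑ j ∈ Finset.range J, hj j = ∫ x, χ x * g x := by
    rw [hhj]
    simp only
    rw [← integral_finsetSum _ fun j _ => hintj j]
    refine integral_congr_ae (ae_of_all _ fun x => ?_)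
    simp only
    rw [← Finset.sum_mul, sum_indicator_shellSet hA hJ χ hR' hsupp x]
  obtain ⟨j, hjJ, hle⟩ := pigeonhole_sq_weights hj hH hsum
  refine ⟨j, hjJ, ?_⟩
  rw [mul_comm (4 : ℝ)] at hle
  have hset : ∫ x in Metric.ball (0 : E3) (2 ^ (j + 1) * A), (shellSet A j).indicator χ x * g x = hj j := by
    rw [hhj]
    refine setIntegral_eq_integral_of_forall_compl_eq_zero fun x hx => ?_
    have hx' : x ∉ shellSet A j := fun h => hx (shellSet_subset_ball A j h)
    simp [Set.indicator_of_notMem hx']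
  rw [hset]
  simpa [mul_comm] using hle

/-! ### K4 itself: the ANCHOR RACE (assembly of helpers 1–8) -/

open Literature.Analysis.FluidPDE in
/-- **The anchor race** (K4): given the shell helicity floor (K2) and the far-volume bound (K3), no member of the class (any `ρ > 0`) lies in the
chiral-tube stratum while having anchor flows. -/
theorem anchorRace (hK2 : ShellHelicityFloor) (hK3 : FarVolumeBound) :
    ∀ ρ : ℝ, 0 < ρ → ∀ (u : ℝ → E3 → E3) (p : ℝ → E3 → ℝ) (H : ℝ → E3 → E3 →L[ℝ] E3) (c : ℝ≥0),
      InClass ρ u p H c → IsChiralTubePast u p → HasAnchorFlows u → False := by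
  classical
  intro ρ hρ u p H c hcls htube hflows
  obtain ⟨hcl, t₀, ht₀, hslab, χ, R₀, hR₀, hdatum, hH₀⟩ := htube
  obtain ⟨C₁, hC₁, hfloor⟩ := memberShellFloor hK2
  obtain ⟨C₂, hC₂, hfar⟩ := farLabelVolume hK3
  have hA_gauge : ∀ a : ℝ, 0 < a → ENNReal.ofReal (a ^ (2 * ρ)) * cknA a (0 : ℝ × E3) u ≤ (c : ℝ≥0∞) :=
    fun a ha => le_trans (le_trans le_self_add le_self_add) (hcls.2.2 a ha)
  have ht₀' : t₀ ∈ Set.Iio (0 : ℝ) := ht₀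
  -- the label set
  set L : Set E3 := {x : E3 | χ x ≠ 0} with hLdef
  have hχc : Continuous χ := hdatum.1.continuous
  have hLopen : IsOpen L := isOpen_ne_fun hχc continuous_const
  have hLm : MeasurableSet L := hLopen.measurableSet
  have hLball : L ⊆ Metric.ball (0 : E3) R₀ := by
    intro x hx
    rw [Metric.mem_ball, dist_zero_right]
    by_contra h
    exact hx (hdatum.2.2.1 x (not_lt.1 h))
  have hLfin : volume L < ⊤ := (measure_mono hLball).trans_lt measure_ball_lt_top
  have hLne : L.Nonempty := by
    by_contra hne
    apply hH₀
    refine integral_eq_zero_of_ae (ae_of_all _ fun x => ?_)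
    have : χ x = 0 := by
      by_contra h
      exact hne ⟨x, h⟩
    simp [this]
  set v₀ : ℝ := (volume L).toReal with hv₀def
  have hv₀ : 0 < v₀ := ENNReal.toReal_pos (hLopen.measure_pos volume hLne).ne' hLfin.ne
  -- `c > 0` (else the `A`-gauge kills the slice `u t₀` on a ball containing the tube, so its helicity vanishes)
  have hc : 0 < (c : ℝ) := by
    by_contra hcn
    have hc0 : (c : ℝ) = 0 := le_antisymm (not_lt.1 hcn) c.coe_nonneg
    apply hH₀
    set a : ℝ := R₀ + Real.sqrt (-t₀) + 1 with hadef
    have hsq : 0 ≤ Real.sqrt (-t₀) := Real.sqrt_nonneg _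
    have ha : 0 < a := by rw [hadef]; linarith
    have hat₀ : t₀ ∈ Set.Ioo (-(a ^ 2)) 0 := by
      refine ⟨?_, ht₀⟩
      have h1 : Real.sqrt (-t₀) ^ 2 = -t₀ := Real.sq_sqrt (by linarith)
      have h2 : Real.sqrt (-t₀) < a := by rw [hadef]; linarith
      nlinarith
    have hball := Backward.lintegral_ball_le_of_gaugeA (u := u) ha (hA_gauge a ha) hat₀
    rw [hc0, zero_mul, ENNReal.ofReal_zero, nonpos_iff_eq_zero] at hball
    have hv0c : Continuous (u t₀) := (hcl.contDiff_velocity ht₀').continuous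
    have hae : ∀ᵐ x ∂(volume.restrict (Metric.ball (0 : E3) a)), u t₀ x = 0 := by
      have hm : AEMeasurable (fun x => ‖u t₀ x‖ₑ ^ 2) (volume.restrict (Metric.ball (0 : E3) a)) :=
        (hv0c.measurable.enorm.pow_const 2).aemeasurable
      have := (lintegral_eq_zero_iff' hm).1 hball
      filter_upwards [this] with x hx
      simpa using hx
    have hae' : ∀ᵐ x ∂(volume : Measure E3), x ∈ Metric.ball (0 : E3) a → u t₀ x = 0 :=
      (ae_restrict_iff' measurableSet_ball).1 hae
    refine integral_eq_zero_of_ae ?_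
    filter_upwards [hae'] with x hx
    by_cases hxb : x ∈ Metric.ball (0 : E3) a
    · simp [hx hxb]
    · have : χ x = 0 := hdatum.2.2.1 x (by
        rw [Metric.mem_ball, dist_zero_right, not_lt] at hxb
        rw [hadef] at hxb; linarith)
      simp [this]
  -- constants, scale, window
  set h : ℝ := |tubeHelicity (u t₀) χ| with hhdef
  have hh : 0 < h := abs_pos.2 hH₀
  obtain ⟨K₁, K₂, K₃, hK₁, hK₂, hK₃, hrace⟩ := raceSeries hρ hC₁ hC₂ hc hh hv₀
  obtain ⟨A₀, hA₀1, hA₀⟩ := exponent_race hρ K₁ K₂ K₃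
  set A : ℝ := max A₀ (max R₀ (Real.sqrt (-t₀) + 1)) with hAdef
  have hA1 : 1 ≤ A := hA₀1.trans (le_max_left _ _)
  have hA0 : 0 < A := by linarith
  have hAR₀ : R₀ ≤ A := (le_max_left _ _).trans (le_max_right _ _)
  have hAsq : -t₀ < A ^ 2 := by
    have h1 : Real.sqrt (-t₀) ^ 2 = -t₀ := Real.sq_sqrt (by linarith)
    have h2 : Real.sqrt (-t₀) + 1 ≤ A := (le_max_right _ _).trans (le_max_right _ _)
    have h3 : 0 ≤ Real.sqrt (-t₀) := Real.sqrt_nonneg _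
    nlinarith
  set t₁ : ℝ := t₀ - A ^ 2 with ht₁def
  have ht₁ : t₁ < t₀ := by rw [ht₁def]; nlinarith
  have hlen : t₀ - t₁ ≤ A ^ 2 := by rw [ht₁def]; linarith
  have ht₁low : -((2 * A) ^ 2) < t₁ := by rw [ht₁def]; nlinarith
  obtain ⟨B, hB⟩ := hslab t₁ ht₁
  obtain ⟨X, χ', hX, hTr⟩ := hflows t₀ ht₀ t₁ ht₁ ⟨B, hB⟩ χ R₀ hR₀ hdatum
  obtain ⟨R', hR'⟩ := hX.2.2.2.2.2.2
  obtain ⟨J₀, hJ₀⟩ := pow_unbounded_of_one_lt (R' / A) one_lt_two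
  set J : ℕ := J₀ + 1 with hJdef
  have hJ1 : 1 ≤ J := by omega
  have hJ : R' ≤ 2 ^ J * A := by
    have h1 : R' < 2 ^ J₀ * A := by rwa [div_lt_iff₀ hA0] at hJ₀
    have h2 : (2 : ℝ) ^ J₀ * A ≤ 2 ^ J * A :=
      mul_le_mul_of_nonneg_right (pow_le_pow_right₀ one_le_two (by omega)) hA0.le
    linarith
  -- shells: radii, floors
  have hRad_ge : ∀ j : ℕ, 2 * A ≤ shellRad A j := fun j => by
    unfold shellRad
    have : (2 : ℝ) ^ 1 ≤ 2 ^ (j + 1) := pow_le_pow_right₀ one_le_two (by omega)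
    nlinarith
  have hsubj : ∀ j : ℕ, Set.Ioo t₁ t₀ ⊆ Set.Ioo (-(shellRad A j ^ 2)) 0 := by
    intro j s hs
    refine ⟨?_, hs.2.trans ht₀⟩
    have h1 := hRad_ge j
    have h2 : (2 * A) ^ 2 ≤ shellRad A j ^ 2 := pow_le_pow_left₀ (by positivity) h1 2
    linarith [hs.1]
  set e : ℕ → ℝ := fun j => eFloor ρ C₁ (c : ℝ) h (shellVol ρ C₂ (c : ℝ) v₀ A j) (shellRad A j) j with hedef
  have he : ∀ j, 0 < e j := fun j =>
    eFloor_pos hC₁ hc hh (shellVol_pos hC₂ hc hv₀ hA0 j) (shellRad_pos hA0 j) j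
  set F : ℝ → ℝ → ℝ := fun a s => ∫ x in Metric.ball (0 : E3) a, frobeniusNormSq (fderiv ℝ (u s) x) with hFdef
  -- per-slice floors
  have hslice : ∀ s ∈ Set.Ioo t₁ t₀, ∃ j, j < J ∧ e j ≤ F (shellRad A j) s := by
    intro s hs
    have hsI : s ∈ Set.Icc t₁ t₀ := ⟨hs.1.le, hs.2.le⟩
    have hs0 : s ∈ Set.Iio (0 : ℝ) := hs.2.trans ht₀
    obtain ⟨⟨R's, hR's, hdat⟩, hlab, hsupp, hhel⟩ := hTr.2 s hsI
    have hvs : ContDiff ℝ 1 (u s) := (hcl.contDiff_velocity hs0).of_le (by norm_cast)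
    have hχ'c : Continuous (χ' s) := hdat.1.continuous
    have hcurlc : Continuous (curl (u s)) := by
      rw [curl_eq_curlCLM_comp]; exact curlCLM.continuous.comp (hvs.continuous_fderiv one_ne_zero)
    set g : E3 → ℝ := fun x => inner ℝ (u s x) (curl (u s) x) with hgdef
    have hgc : Continuous g := hvs.continuous.inner hcurlc
    have hint : Integrable (fun x => χ' s x * g x) := by
      refine (hχ'c.mul hgc).integrable_of_hasCompactSupport ?_
      refine HasCompactSupport.intro (isCompact_closedBall (0 : E3) R's) fun x hx => ?_
      rw [Metric.mem_closedBall, dist_zero_right, not_le] at hx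
      simp [hdat.2.2.1 x hx.le]
    have hsuppR' : ∀ x : E3, χ' s x ≠ 0 → ‖x‖ < R' := by
      intro x hx
      have := hR' s hsI (hsupp x hx)
      rwa [Metric.mem_ball, dist_zero_right] at this
    have hHs_eq : ∫ x, χ' s x * g x = tubeHelicity (u t₀) χ := hhel
    have hHs : ∫ x, χ' s x * g x ≠ 0 := by rw [hHs_eq]; exact hH₀
    obtain ⟨j, hjJ, hj⟩ := hostingShell hint hA0 hsuppR' hJ1 hJ hHs
    rw [hHs_eq, ← hhdef] at hj
    refine ⟨j, hjJ, ?_⟩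
    -- the weight and its label set
    set w : E3 → ℝ := (shellSet A j).indicator (χ' s) with hwdef
    have hwm : Measurable w := hχ'c.measurable.indicator (measurableSet_shellSet A j)
    have hw1 : ∀ x : E3, |w x| ≤ 1 := by
      intro x
      rw [hwdef, Set.indicator_apply]
      split_ifs
      · exact hdat.2.1 x
      · simp
    have hwne : ∀ x : E3, w x ≠ 0 → x ∈ shellSet A j ∧ χ' s x ≠ 0 := by
      intro x hx
      rw [hwdef, Set.indicator_apply] at hx
      split_ifs at hx with hmem
      · exact ⟨hmem, hx⟩
      · exact absurd rfl hx
    have hsR : s ∈ Set.Ioo (-(shellRad A j ^ 2)) 0 := hsubj j hs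
    have hηle : eta h j ≤ |∫ x in Metric.ball (0 : E3) (shellRad A j), w x * inner ℝ (u s x) (curl (u s) x)| := by
      unfold eta shellRad; exact hj
    -- label subset `E ⊆ L` whose image carries `w`, with `vol(E) ≤ shellVol j`
    obtain ⟨E, hEL, hEm, hEvol, hwE⟩ : ∃ E : Set E3, E ⊆ L ∧ MeasurableSet E ∧
        (volume E).toReal ≤ shellVol ρ C₂ (c : ℝ) v₀ A j ∧ ∀ x : E3, w x ≠ 0 → x ∈ X s '' E := by
      rcases Nat.eq_zero_or_pos j with hj0 | hjpos
      · subst hj0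
        refine ⟨L, subset_rfl, hLm, le_rfl, fun x hx => hsupp x (hwne x hx).2⟩
      · obtain ⟨i, rfl⟩ : ∃ i, j = i + 1 := ⟨j - 1, by omega⟩
        have hRi : (2 : ℝ) * R₀ ≤ 2 ^ (i + 1) * A := by
          have : (2 : ℝ) ^ 1 ≤ 2 ^ (i + 1) := pow_le_pow_right₀ one_le_two (by omega)
          nlinarith
        have hAi : A ≤ 2 ^ (i + 1) * A := by
          have : (1 : ℝ) ≤ 2 ^ (i + 1) := one_le_pow₀ one_le_two
          nlinarith
        have hti : -(2 ^ (i + 1) * A) ^ 2 < t₁ := by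
          have h1 : (2 * A) ^ 2 ≤ (2 ^ (i + 1) * A) ^ 2 := by
            have : (2 : ℝ) * A ≤ 2 ^ (i + 1) * A := by
              have : (2 : ℝ) ^ 1 ≤ 2 ^ (i + 1) := pow_le_pow_right₀ one_le_two (by omega)
              nlinarith
            exact pow_le_pow_left₀ (by positivity) this 2
          linarith
        obtain ⟨hEm, hEvol⟩ := hfar ρ hρ u p H c hcls hcl t₁ t₀ L X ht₁ ht₀ hLm hX R₀ hR₀ hLball A hA1 hlen
          (2 ^ (i + 1) * A) hRi hAi hti s hsI
        refine ⟨{y : E3 | y ∈ L ∧ 2 ^ (i + 1) * A ≤ ‖X s y‖}, fun y hy => hy.1, hEm, ?_, ?_⟩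
        · simpa only [shellVol] using hEvol
        · intro x hx
          obtain ⟨hxs, hxχ⟩ := hwne x hx
          obtain ⟨y, hyL, rfl⟩ := hsupp x hxχ
          refine ⟨y, ⟨hyL, ?_⟩, rfl⟩
          rcases hxs.1 with h0 | hle
          · omega
          · exact hle
    obtain ⟨hTm, hTvol⟩ := hX.2.2.2.2.1 s hsI E hEL hEm
    have hTfin : volume (X s '' E) < ⊤ := by
      rw [hTvol]; exact (measure_mono hEL).trans_lt hLfin
    have hTV : (volume (X s '' E)).toReal ≤ shellVol ρ C₂ (c : ℝ) v₀ A j := by rw [hTvol]; exact hEvol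
    have hwT : ∀ x : E3, x ∉ X s '' E → w x = 0 := by
      intro x hx; by_contra h; exact hx (hwE x h)
    have := hfloor ρ hρ u p H c hcls hcl (shellRad A j) (shellRad_pos hA0 j) s hsR w hwm hw1 (X s '' E) hTm hTfin hwT
      (shellVol ρ C₂ (c : ℝ) v₀ A j) hTV (eta h j) (eta_pos hh j) hηle
    simpa only [hedef, eFloor, hFdef] using this
  -- the time integral
  have hmeasF : ∀ j : ℕ, AEMeasurable (fun s : ℝ => ENNReal.ofReal (F (shellRad A j) s)) (volume.restrict (Set.Ioo t₁ t₀)) :=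
    fun j => ((windowBudget hcls hcl (shellRad_pos hA0 j)).1).mono_measure (Measure.restrict_mono (hsubj j) le_rfl)
  have hbudget : ∀ j : ℕ, ∫⁻ s in Set.Ioo t₁ t₀, ENNReal.ofReal (F (shellRad A j) s) ≤
      ENNReal.ofReal ((c : ℝ) * shellRad A j ^ (1 - ρ)) :=
    fun j => (lintegral_mono_set (hsubj j)).trans (windowBudget hcls hcl (shellRad_pos hA0 j)).2
  have hpt : ∀ s ∈ Set.Ioo t₁ t₀,
      (1 : ℝ≥0∞) ≤ ∑ j ∈ Finset.range J, ENNReal.ofReal (F (shellRad A j) s) * (ENNReal.ofReal (e j))⁻¹ := by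
    intro s hs
    obtain ⟨j, hjJ, hej⟩ := hslice s hs
    have h1 : (1 : ℝ≥0∞) ≤ ENNReal.ofReal (F (shellRad A j) s) * (ENNReal.ofReal (e j))⁻¹ := by
      rw [← div_eq_mul_inv, ENNReal.le_div_iff_mul_le (Or.inl ((ENNReal.ofReal_pos.2 (he j)).ne'))
        (Or.inl ENNReal.ofReal_ne_top), one_mul]
      exact ENNReal.ofReal_le_ofReal hej
    exact h1.trans (Finset.single_le_sum (f := fun j => ENNReal.ofReal (F (shellRad A j) s) * (ENNReal.ofReal (e j))⁻¹)
      (fun _ _ => zero_le) (Finset.mem_range.2 hjJ))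
  have hterm0 : ∀ j, 0 ≤ (c : ℝ) * shellRad A j ^ (1 - ρ) / e j := fun j =>
    div_nonneg (mul_nonneg c.coe_nonneg (Real.rpow_nonneg (shellRad_pos hA0 j).le _)) (he j).le
  have hmain : ENNReal.ofReal (A ^ 2) ≤
      ENNReal.ofReal (K₁ * A ^ (1 - ρ) + K₂ * A ^ (2 - 2 * ρ) + K₃ * A ^ (2 - 5 * ρ)) := by
    calc ENNReal.ofReal (A ^ 2) = volume (Set.Ioo t₁ t₀) := by
          rw [Real.volume_Ioo, ht₁def]; congr 1; ring
      _ = ∫⁻ s in Set.Ioo t₁ t₀, (1 : ℝ≥0∞) := by rw [setLIntegral_const, one_mul]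
      _ ≤ ∫⁻ s in Set.Ioo t₁ t₀, ∑ j ∈ Finset.range J, ENNReal.ofReal (F (shellRad A j) s) * (ENNReal.ofReal (e j))⁻¹ :=
          lintegral_mono_ae ((ae_restrict_iff' measurableSet_Ioo).2 (ae_of_all _ hpt))
      _ = ∑ j ∈ Finset.range J, ∫⁻ s in Set.Ioo t₁ t₀, ENNReal.ofReal (F (shellRad A j) s) * (ENNReal.ofReal (e j))⁻¹ :=
          lintegral_finsetSum' _ fun j _ => (hmeasF j).mul_const _
      _ = ∑ j ∈ Finset.range J, (∫⁻ s in Set.Ioo t₁ t₀, ENNReal.ofReal (F (shellRad A j) s)) * (ENNReal.ofReal (e j))⁻¹ := by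
          refine Finset.sum_congr rfl fun j _ => ?_
          rw [lintegral_mul_const'' _ (hmeasF j)]
      _ ≤ ∑ j ∈ Finset.range J, ENNReal.ofReal ((c : ℝ) * shellRad A j ^ (1 - ρ)) * (ENNReal.ofReal (e j))⁻¹ :=
          Finset.sum_le_sum fun j _ => mul_le_mul_of_nonneg_right (hbudget j) zero_le
      _ = ∑ j ∈ Finset.range J, ENNReal.ofReal ((c : ℝ) * shellRad A j ^ (1 - ρ) / e j) := by
          refine Finset.sum_congr rfl fun j _ => ?_
          rw [ENNReal.ofReal_div_of_pos (he j), div_eq_mul_inv]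
      _ = ENNReal.ofReal (∑ j ∈ Finset.range J, (c : ℝ) * shellRad A j ^ (1 - ρ) / e j) :=
          (ENNReal.ofReal_sum_of_nonneg fun j _ => hterm0 j).symm
      _ ≤ _ := ENNReal.ofReal_le_ofReal (hrace A hA1 J)
  have hfin := hA₀ A (le_max_left _ _)
  have hpos : 0 ≤ K₁ * A ^ (1 - ρ) + K₂ * A ^ (2 - 2 * ρ) + K₃ * A ^ (2 - 5 * ρ) := by
    have := Real.rpow_pos_of_pos hA0 (1 - ρ); have := Real.rpow_pos_of_pos hA0 (2 - 2 * ρ)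
    have := Real.rpow_pos_of_pos hA0 (2 - 5 * ρ); positivity
  have := (ENNReal.ofReal_le_ofReal_iff hpos).1 hmain
  linarith

end Summit.NavierStokesRegularity.NavierStokesRegularity.Cruxes.PowerGaugeEulerLiouville.ChiralAnchorK4
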